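import Mathlib
import HarnessLib
import Literature.NumberTheory.LFunctions.VanDerCorputZeta

/-!
# The double large sieve of Bombieri–Iwaniec (general dimension), PROVED

Topic `Literature/NumberTheory/LFunctions`. This file proves, sorry-free and in arbitrary finite
dimension `K = #ι`, the two basic mean-value inequalities behind the Bombieri–Iwaniec method for
exponential sums, in the form printed by Graham–Kolesnik, *Van der Corput's Method of Exponential
Sums* (LMS Lecture Notes 126, CUP 1991), §7.2, Lemmas 7.4 and 7.5 (pp. 61–62 of the copy read):

* **Lemma 7.4 (large-sieve mean value with neighbour count).** For points `𝐩 ∈ 𝐏 ⊂ ℝ^K`,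
  weights `b(𝐩) ∈ ℂ` and `δ_k, T_k > 0`,
  `∫_{-T_1}^{T_1}⋯∫_{-T_K}^{T_K} |∑_𝐩 b(𝐩) e(𝐩·𝐭)|² d𝐭 ≤ ∏_k (2T_k + δ_k⁻¹) ∑_{|p_j - p'_j| ≤ δ_j} |b(𝐩) b(𝐩')|`
  (G–K prove it with the Beurling–Selberg majorant).
* **Lemma 7.5 (double large sieve).** For `𝐗, 𝐘 ⊂ ℝ^K` finite, weights `a(𝐱), b(𝐲)`,
  `|x_k| ≤ X_k`, `|y_k| ≤ Y_k`:
  `|∑_𝐱 ∑_𝐲 a(𝐱) b(𝐲) e(𝐱·𝐲)|² ≤ (2π²)^K ∏_k (1 + X_k Y_k) 𝓑(b; 𝐗) 𝓑(a; 𝐘)`, with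
  `𝓑(b; 𝐗) = ∑_{|y_k - y'_k| ≤ (2X_k)⁻¹} |b(𝐲) b(𝐲')|`, `𝓑(a; 𝐘) = ∑_{|x_k - x'_k| ≤ (2Y_k)⁻¹} |a(𝐱) a(𝐱')|`.
  This is Bombieri–Iwaniec's Lemma 2.4 ([B-I1]), Huxley–Watt's Lemma 3.6, Huxley's Lemma 5.6.6, and
  the inequality (3.8) of Bourgain, *JAMS* 30 (2017).

What is proved here are the SAME inequalities with weaker absolute constants — `13^K ∏(T_k + δ_k⁻¹)`
in Lemma 7.4 (`largeSieve_meanValue`) and `624^K ∏(1 + X_k Y_k)` in Lemma 7.5 (`doubleLargeSieve`) —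
which is all that any `≪`-application uses (Bourgain's (3.8)–(3.9), step 2 of the printed proof of
his Theorem 4, `Literature/NumberTheory/LFunctions/BourgainTheorem4.lean`; the Robert–Sargos
fourth-derivative test, `RobertSargosFourthDerivative.lean`; Huxley's method generally).

## Proof (elementary; no Beurling–Selberg function, no Fourier inversion)

* Mean value (§ "kernel form", "cell argument"): for `𝐬` in the box `B = ∏[-T_k, T_k]` one has
  `B ⊆ 𝐬 + 2B`, so `∫_B |G|² ≤ ∫_{𝐬+2B} |G|²`; averaging over `𝐬 ∈ B` and expanding `|G|²` gives
  `∫_B |G|² ≤ ∑_{q,q'} |b_q b_{q'}| ∏_k κ_{T_k}(y_{q,k} - y_{q',k})` with the Fejér-type kernel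
  `κ_T(u) = |K_{2T}(u)| |K_T(u)| / (2T) ≤ min(4T, 1/(2π² T u²))`, `K_R(u) = ∫_{-R}^{R} e(tu) dt`
  (`integral_normSq_trigSum_le_kern`). Decomposing `ℝ^K` into cells of sides `δ_k`, the kernel is
  dominated by a lattice function `g` of the cell difference with `∑_{ℤ} g ≤ 13 T_k` per coordinate
  (when `T_k δ_k ≥ 1`), and the Schur test on cells bounds the quadratic form by
  `∏(13 T_k) · ∑_cells (cell mass)² ≤ ∏(13 T_k) · 𝓝(b; δ)` (`kernelSum_le`); finally `T_k` is enlarged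
  to `max(T_k, δ_k⁻¹) ≤ T_k + δ_k⁻¹`.
* Double large sieve (G–K's proof): `e(𝐱·𝐲) = C(𝐲) ∫_{∏[x_k-ε_k, x_k+ε_k]} e(𝐭·𝐲) d𝐭` with
  `ε_k = 1/(8Y_k)` and `|C(𝐲)| ≤ ∏ 8Y_k` (since `Re K_ε(u) ≥ ε` when `|u| ε ≤ 1/8`, from
  `cos θ ≥ 1 - θ²/2`); then Cauchy–Schwarz in `𝐭` over the box `∏[-X_k-ε_k, X_k+ε_k]`, the first factor
  being `≤ ∏(2ε_k) 𝓝(a; 2ε)` (disjointness of boxes around non-neighbouring points) and the second the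
  mean value above at scale `(2X_k)⁻¹` for the weights `b C`.

## Content (all PROVED; namespace `Literature.NumberTheory.LFunctions.DoubleLargeSieve`)

* `K`, `kern`, `trigSum`, `neighbourCount` (`𝓝(b; δ)`, G–K's `𝓑`), `gker`, `Gker` — definitions
  (`e = Literature.NumberTheory.LFunctions.VdC.e` from `VanDerCorputZeta.lean`).
* `largeSieve_meanValue` — Lemma 7.4 with constant `13^K`.
* `doubleLargeSieve` — Lemma 7.5 with constant `624^K` (thresholds `(2Y_k)⁻¹`, `(2X_k)⁻¹` as printed).
* `neighbourCount_le_integral` — the converse "first spacing lemma" (the Fejér-minorant bound behind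
  [H] Lemma 5.6.5 / Bourgain's (3.10) `A ≤ (π⁸/4) A₆`): `𝓝(b; 1/(2X)) ≤ 8^K ∏ X_k⁻¹ ∫_{∏[-X_k,X_k]} |∑_q |b_q| e(t·y_q)|² dt`
  (added 2026-08-15, second revision; `conj_K`, `K_eq_re`: `K_R(v)` is real).
* Counting forms (third revision): `closePairs` (`#` of `δ`-close ordered pairs, Bourgain's `A`, `B₁`
  of (3.9) with `≤`), `doubleLargeSieve_count` ((3.8)-shape: unimodular weights, counts `A·B`),
  `trigSum_piFinset_one` (`∑_{𝐡∈A^J} e(z·∑_jφ(h_j)) = (∑_{a∈A} e(z·φ(a)))^{#J}`) and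
  `closePairs_piFinset_le_integral` (first-spacing count `≤ 8^K ∏X_k⁻¹ ∫ |∑_a e(z·φ(a))|^{2#J}`, the
  shape of the display before (3.10)).
* Tools: `setIntegral_Icc_prod` (Fubini over a box for product integrands), `norm_integral_e_le_sub`,
  `norm_integral_e_le_inv` (`|∫_a^b e(tv)dt| ≤ min(b - a, 1/(π|v|))`), `integral_normSq_trigSum_eq`
  (exact mean square over a box), `integral_sq_sum_indicator_le`, `neighbourCount_mono`,
  `neighbourCount_mul_le`.

## Not here

The sharp constants (`2T + δ⁻¹`, `(2π²)^K`), the variant with `‖y_k‖` (distance to the nearest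
integer) for integral `x_k` (G–K, remark after Lemma 7.5), and the applications (first/second spacing
problems) are not treated.

## References

* S. W. Graham, G. Kolesnik, *Van der Corput's Method of Exponential Sums*, LMS Lecture Note Series
  126, Cambridge Univ. Press 1991, doi:10.1017/cbo9780511661976 — §7.2, Lemma 7.4, Lemma 7.5 (pp. 61–62).
* [B-I1] E. Bombieri, H. Iwaniec, *On the order of `ζ(1/2 + it)`*, Ann. Scuola Norm. Sup. Pisa Cl. Sci.
  (4) 13 (1986), 449–472 — Lemma 2.4 (the original double large sieve).
* M. N. Huxley, N. Watt, *Exponential sums and the Riemann zeta function*, Proc. London Math. Soc. (3)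
  57 (1988), 1–24 — Lemma 3.6.
* J. Bourgain, *Decoupling, exponential sums and the Riemann zeta function*, J. Amer. Math. Soc. 30
  (2017), 205–224 — (3.8).
-/

noncomputable section

open Complex MeasureTheory Set Finset
open scoped Real ComplexConjugate

namespace Literature.NumberTheory.LFunctions
namespace DoubleLargeSieve

open Literature.NumberTheory.LFunctions.VdC (e norm_e e_add e_zero e_neg)

/-! ### The exponential `e(x) = exp(2πix)`

We use `Literature.NumberTheory.LFunctions.VdC.e` (`VanDerCorputZeta.lean`) and its API
(`norm_e`, `e_add`, `e_zero`, `e_neg`). -/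

/-- `conj e(θ) = e(-θ)`. [folklore] -/
theorem conj_e (θ : ℝ) : conj (e θ) = e (-θ) := (e_neg θ).symm

/-- `e(∑ f_k) = ∏ e(f_k)`. [folklore] -/
theorem e_sum {κ : Type*} (s : Finset κ) (f : κ → ℝ) : e (∑ k ∈ s, f k) = ∏ k ∈ s, e (f k) := by
  classical
  induction s using Finset.induction_on with
  | empty => simp [e_zero]
  | insert a s ha ih => rw [Finset.sum_insert ha, Finset.prod_insert ha, e_add, ih]

/-- `e` is continuous. [folklore] -/
theorem continuous_e : Continuous e := by
  unfold VdC.e; fun_prop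

/-- `e(tv) = exp((2πiv) t)`, the form used with `integral_exp_mul_complex`. [folklore] -/
theorem e_mul_eq_exp (t v : ℝ) : e (t * v) = Complex.exp ((2 * π * I * v) * (t : ℂ)) := by
  unfold VdC.e; congr 1; push_cast; ring

/-! ### One-dimensional kernels -/

/-- `‖∫_a^b e(tv) dt‖ ≤ b - a`. [folklore] -/
theorem norm_integral_e_le_sub {a b : ℝ} (hab : a ≤ b) (v : ℝ) :
    ‖∫ t in a..b, e (t * v)‖ ≤ b - a := by
  have h := intervalIntegral.norm_integral_le_of_norm_le_const (a := a) (b := b) (C := 1)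
    (f := fun t => e (t * v)) (fun x _ => (norm_e _).le)
  rwa [abs_of_nonneg (sub_nonneg.2 hab), one_mul] at h

/-- `‖∫_a^b e(tv) dt‖ ≤ 1/(π |v|)` for `v ≠ 0`. [folklore] -/
theorem norm_integral_e_le_inv (a b : ℝ) {v : ℝ} (hv : v ≠ 0) :
    ‖∫ t in a..b, e (t * v)‖ ≤ 1 / (π * |v|) := by
  have hc : (2 * π * I * v : ℂ) ≠ 0 := by
    simp [Real.pi_ne_zero, Complex.I_ne_zero, hv]
  simp_rw [e_mul_eq_exp]
  rw [integral_exp_mul_complex hc, norm_div]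
  have hn : ‖(2 * π * I * v : ℂ)‖ = 2 * π * |v| := by
    simp [abs_of_pos Real.pi_pos]
  rw [hn]
  have h1 : ∀ x : ℝ, ‖Complex.exp (2 * π * I * v * (x : ℂ))‖ = 1 := fun x => by
    rw [← e_mul_eq_exp]; exact norm_e _
  have hnum : ‖Complex.exp (2 * π * I * v * (b : ℂ)) - Complex.exp (2 * π * I * v * (a : ℂ))‖ ≤ 2 :=
    (norm_sub_le _ _).trans (by rw [h1, h1]; norm_num)
  have hpos : 0 < 2 * π * |v| := by positivity
  rw [div_le_div_iff₀ hpos (by positivity)]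
  nlinarith

/-- Translation: `∫_{s-R}^{s+R} e(tv) dt = e(sv) ∫_{-R}^{R} e(tv) dt`. [folklore] -/
theorem integral_e_shift (s R v : ℝ) :
    ∫ t in (s - R)..(s + R), e (t * v) = e (s * v) * ∫ t in (-R)..R, e (t * v) := by
  rw [show s - R = -R + s by ring, show s + R = R + s by ring,
    ← intervalIntegral.integral_comp_add_right (fun t => e (t * v)) s,
    ← intervalIntegral.integral_const_mul]
  congr 1; ext t
  rw [← e_add]; congr 1; ring

/-- The set integral over `Icc (s-R) (s+R)` as the translated interval integral. [folklore] -/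
theorem setIntegral_Icc_e_shift (s v : ℝ) {R : ℝ} (hR : 0 ≤ R) :
    ∫ t in Set.Icc (s - R) (s + R), e (t * v) = e (s * v) * ∫ t in (-R)..R, e (t * v) := by
  rw [integral_Icc_eq_integral_Ioc, ← intervalIntegral.integral_of_le (by linarith),
    integral_e_shift]

/-! ### Box integrals of product functions -/

variable {ι : Type*} [Fintype ι]

/-- Fubini for a product function over a box `Icc lo hi ⊆ ℝ^ι`. [folklore] -/
theorem setIntegral_Icc_prod (lo hi : ι → ℝ) (f : ι → ℝ → ℂ) :
    ∫ t in Set.Icc lo hi, ∏ k, f k (t k) = ∏ k, ∫ x in Set.Icc (lo k) (hi k), f k x := by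
  rw [← Set.pi_univ_Icc, MeasureTheory.volume_pi, Measure.restrict_pi_pi,
    integral_fintype_prod_eq_prod (f := fun k x => f k x)]

/-- `∫_{Icc (s-R) (s+R)} e(t·v) dt = ∏_k e(s_k v_k) ∫_{-R_k}^{R_k} e(t v_k) dt`. [folklore] -/
theorem setIntegral_box_e (s R v : ι → ℝ) (hR : ∀ k, 0 ≤ R k) :
    ∫ t in Set.Icc (s - R) (s + R), ∏ k, e (t k * v k) =
      ∏ k, (e (s k * v k) * ∫ x in (-(R k))..(R k), e (x * v k)) := by
  rw [setIntegral_Icc_prod (s - R) (s + R) (fun k x => e (x * v k))]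
  refine Finset.prod_congr rfl fun k _ => ?_
  simp only [Pi.sub_apply, Pi.add_apply]
  exact setIntegral_Icc_e_shift (s k) (v k) (hR k)

/-- `∫_{Icc (-R) R} e(tv) dt` as an interval integral. [folklore] -/
theorem setIntegral_Icc_e_symm (v : ℝ) {R : ℝ} (hR : 0 ≤ R) :
    ∫ t in Set.Icc (-R) R, e (t * v) = ∫ t in (-R)..R, e (t * v) := by
  rw [integral_Icc_eq_integral_Ioc, ← intervalIntegral.integral_of_le (by linarith)]

/-! ### The one-dimensional kernel `K_R(u) = ∫_{-R}^{R} e(tu) dt` -/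

/-- `K R u = ∫_{-R}^{R} e(tu) dt` (`= sin(2πRu)/(πu)`, `= 2R` at `u = 0`). [folklore] -/
def K (R u : ℝ) : ℂ := ∫ t in (-R)..R, e (t * u)

/-- `|K_R(u)| ≤ 2R`. [folklore] -/
theorem norm_K_le {R : ℝ} (hR : 0 ≤ R) (u : ℝ) : ‖K R u‖ ≤ 2 * R := by
  have h := norm_integral_e_le_sub (show -R ≤ R by linarith) u
  rw [K]; linarith

/-- `|K_R(u)| ≤ 1/(π|u|)` for `u ≠ 0`. [folklore] -/
theorem norm_K_le_inv (R : ℝ) {u : ℝ} (hu : u ≠ 0) : ‖K R u‖ ≤ 1 / (π * |u|) :=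
  norm_integral_e_le_inv _ _ hu

/-- The averaged kernel `κ_T(u) = ‖K_{2T}(u)‖ ‖K_T(u)‖ / (2T)`. [folklore] -/
def kern (T u : ℝ) : ℝ := ‖K (2 * T) u‖ * ‖K T u‖ / (2 * T)

/-- `κ_T ≥ 0`. [folklore] -/
theorem kern_nonneg {T : ℝ} (hT : 0 < T) (u : ℝ) : 0 ≤ kern T u := by
  unfold kern; positivity

/-- `κ_T(u) ≤ 4T`. [folklore] -/
theorem kern_le {T : ℝ} (hT : 0 < T) (u : ℝ) : kern T u ≤ 4 * T := by
  unfold kern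
  have h1 := norm_K_le (show 0 ≤ 2 * T by linarith) u
  have h2 := norm_K_le hT.le u
  rw [div_le_iff₀ (by linarith)]
  have : ‖K (2 * T) u‖ * ‖K T u‖ ≤ (2 * (2 * T)) * (2 * T) :=
    mul_le_mul h1 h2 (norm_nonneg _) (by linarith)
  linarith

/-- `κ_T(u) ≤ 1/(2π² T u²)` for `u ≠ 0`. [folklore] -/
theorem kern_le_inv {T : ℝ} (hT : 0 < T) {u : ℝ} (hu : u ≠ 0) :
    kern T u ≤ 1 / (2 * π ^ 2 * T * u ^ 2) := by
  unfold kern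
  have h1 := norm_K_le_inv (2 * T) hu
  have h2 := norm_K_le_inv T hu
  have hπu : 0 < π * |u| := by positivity
  have : ‖K (2 * T) u‖ * ‖K T u‖ ≤ (1 / (π * |u|)) * (1 / (π * |u|)) :=
    mul_le_mul h1 h2 (norm_nonneg _) (by positivity)
  rw [div_le_iff₀ (by linarith)]
  calc ‖K (2 * T) u‖ * ‖K T u‖ ≤ (1 / (π * |u|)) * (1 / (π * |u|)) := this
    _ = 1 / (2 * π ^ 2 * T * u ^ 2) * (2 * T) := by
      field_simp
      rw [sq_abs]

/-! ### Trigonometric sums in `ℝ^ι` and the exact mean-square formula on a box -/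

variable {β : Type*}

/-- `G(t) = ∑_{q ∈ s} b_q e(t · y_q)`. [folklore] -/
def trigSum (s : Finset β) (b : β → ℂ) (y : β → ι → ℝ) (t : ι → ℝ) : ℂ :=
  ∑ q ∈ s, b q * e (∑ k, t k * y q k)

/-- `G` is continuous. [folklore] -/
theorem continuous_trigSum (s : Finset β) (b : β → ℂ) (y : β → ι → ℝ) :
    Continuous (trigSum s b y) := by
  unfold trigSum
  refine continuous_finsetSum _ fun q _ => continuous_const.mul (continuous_e.comp ?_)
  fun_prop

/-- `t ↦ ∏_k e(t_k v_k)` is continuous. [folklore] -/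
theorem continuous_prod_e (v : ι → ℝ) : Continuous fun t : ι → ℝ => ∏ k, e (t k * v k) := by
  refine continuous_finsetProd _ fun k _ => continuous_e.comp ?_
  fun_prop

/-- `|G(t)|² = ∑_{q,q'} b_q conj(b_{q'}) ∏_k e(t_k (y_{q,k} - y_{q',k}))`. [folklore] -/
theorem normSq_trigSum_eq (s : Finset β) (b : β → ℂ) (y : β → ι → ℝ) (t : ι → ℝ) :
    (((‖trigSum s b y t‖ ^ 2 : ℝ)) : ℂ) =
      ∑ q ∈ s, ∑ q' ∈ s, b q * conj (b q') * ∏ k, e (t k * (y q k - y q' k)) := by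
  rw [← Complex.normSq_eq_norm_sq, ← Complex.mul_conj, trigSum, map_sum, Finset.sum_mul_sum]
  refine Finset.sum_congr rfl fun q _ => Finset.sum_congr rfl fun q' _ => ?_
  rw [map_mul, conj_e, ← e_sum, mul_mul_mul_comm, ← e_add]
  congr 2
  rw [← Finset.sum_neg_distrib, ← Finset.sum_add_distrib]
  exact Finset.sum_congr rfl fun k _ => by ring

/-- Exact formula: `∫_{Icc lo hi} |G|² = ∑_{q,q'} b_q conj(b_{q'}) ∏_k ∫_{lo_k}^{hi_k} e(x (y_{q,k} - y_{q',k})) dx`. [folklore] -/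
theorem integral_normSq_trigSum_eq (s : Finset β) (b : β → ℂ) (y : β → ι → ℝ) (lo hi : ι → ℝ) :
    ((∫ t in Set.Icc lo hi, ‖trigSum s b y t‖ ^ 2 : ℝ) : ℂ) =
      ∑ q ∈ s, ∑ q' ∈ s, b q * conj (b q') *
        ∏ k, ∫ x in Set.Icc (lo k) (hi k), e (x * (y q k - y q' k)) := by
  rw [← integral_complex_ofReal]
  simp_rw [normSq_trigSum_eq]
  have hint : ∀ q q', IntegrableOn
      (fun t : ι → ℝ => b q * conj (b q') * ∏ k, e (t k * (y q k - y q' k))) (Set.Icc lo hi) :=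
    fun q q' => (continuous_const.mul (continuous_prod_e _)).integrableOn_Icc
  rw [integral_finsetSum _ fun q _ => integrable_finsetSum _ fun q' _ => hint q q']
  refine Finset.sum_congr rfl fun q _ => ?_
  rw [integral_finsetSum _ fun q' _ => hint q q']
  refine Finset.sum_congr rfl fun q' _ => ?_
  rw [integral_const_mul, setIntegral_Icc_prod lo hi (fun k x => e (x * (y q k - y q' k)))]

/-- Nonnegativity and integrability of `|G|²` on boxes. [folklore] -/
theorem integrableOn_normSq_trigSum (s : Finset β) (b : β → ℂ) (y : β → ι → ℝ) (lo hi : ι → ℝ) :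
    IntegrableOn (fun t => ‖trigSum s b y t‖ ^ 2) (Set.Icc lo hi) :=
  ((continuous_trigSum s b y).norm.pow 2).integrableOn_Icc

/-- **Mean square over a box, kernel form.** For `T_k > 0`:
`∫_{[-T,T]} |G|² ≤ ∑_{q,q'} |b_q||b_{q'}| ∏_k κ_{T_k}(y_{q,k} - y_{q',k})`. [folklore] -/
theorem integral_normSq_trigSum_le_kern (s : Finset β) (b : β → ℂ) (y : β → ι → ℝ)
    (T : ι → ℝ) (hT : ∀ k, 0 < T k) :
    ∫ t in Set.Icc (-T) T, ‖trigSum s b y t‖ ^ 2 ≤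
      ∑ q ∈ s, ∑ q' ∈ s, ‖b q‖ * ‖b q'‖ * ∏ k, kern (T k) (y q k - y q' k) := by
  classical
  set L : ℝ := ∫ t in Set.Icc (-T) T, ‖trigSum s b y t‖ ^ 2 with hL
  set T2 : ι → ℝ := fun k => 2 * T k with hT2
  -- the closed form of the mean square over the shifted doubled box
  set Ψ : (ι → ℝ) → ℂ := fun u => ∑ q ∈ s, ∑ q' ∈ s, b q * conj (b q') *
      ∏ k, (e (u k * (y q k - y q' k)) * K (2 * T k) (y q k - y q' k)) with hΨ
  have hΦΨ : ∀ u : ι → ℝ,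
      ((∫ t in Set.Icc (u - T2) (u + T2), ‖trigSum s b y t‖ ^ 2 : ℝ) : ℂ) = Ψ u := by
    intro u
    rw [integral_normSq_trigSum_eq]
    refine Finset.sum_congr rfl fun q _ => Finset.sum_congr rfl fun q' _ => ?_
    congr 1
    refine Finset.prod_congr rfl fun k _ => ?_
    simp only [Pi.sub_apply, Pi.add_apply, hT2]
    rw [setIntegral_Icc_e_shift _ _ (by linarith [hT k]), K]
  have hΨcont : Continuous Ψ := by
    simp only [hΨ]
    refine continuous_finsetSum _ fun q _ => continuous_finsetSum _ fun q' _ =>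
      continuous_const.mul (continuous_finsetProd _ fun k _ => ?_)
    exact (continuous_e.comp (by fun_prop)).mul continuous_const
  -- Step 1: L ≤ Re Ψ(u) for every u in the box
  have hmono : ∀ u ∈ Set.Icc (-T) T, L ≤ (Ψ u).re := by
    intro u hu
    have hsub : Set.Icc (-T) T ⊆ Set.Icc (u - T2) (u + T2) := by
      intro t ht
      simp only [Set.mem_Icc] at hu ht ⊢
      constructor
      · intro k
        have := hu.2 k; have := ht.1 k
        simp only [Pi.sub_apply, Pi.neg_apply, hT2] at *
        linarith
      · intro k
        have := hu.1 k; have := ht.2 k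
        simp only [Pi.add_apply, Pi.neg_apply, hT2] at *
        linarith
    have h1 : L ≤ ∫ t in Set.Icc (u - T2) (u + T2), ‖trigSum s b y t‖ ^ 2 :=
      setIntegral_mono_set (integrableOn_normSq_trigSum _ _ _ _ _)
        (Filter.Eventually.of_forall fun t => by positivity)
        (Filter.Eventually.of_forall hsub)
    have h2 : (∫ t in Set.Icc (u - T2) (u + T2), ‖trigSum s b y t‖ ^ 2) = (Ψ u).re := by
      rw [← hΦΨ u, Complex.ofReal_re]
    linarith
  -- Step 2: integrate over the box
  have hvol : (volume (Set.Icc (-T) T)).toReal = ∏ k, (2 * T k) := by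
    rw [Real.volume_Icc_pi_toReal (fun k => by simp only [Pi.neg_apply]; linarith [hT k])]
    exact Finset.prod_congr rfl fun k _ => by simp only [Pi.neg_apply]; ring
  have hprodpos : 0 < ∏ k, (2 * T k) := Finset.prod_pos fun k _ => by linarith [hT k]
  have hstep2 : L * ∏ k, (2 * T k) ≤ ∫ u in Set.Icc (-T) T, (Ψ u).re := by
    have h1 : ∫ _ in Set.Icc (-T) T, L = L * ∏ k, (2 * T k) := by
      rw [setIntegral_const, smul_eq_mul, measureReal_def, hvol, mul_comm]
    rw [← h1]
    refine setIntegral_mono_on (integrableOn_const ?_) ?_ measurableSet_Icc hmono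
    · exact (measure_Icc_lt_top (a := -T) (b := T)).ne
    · exact (Complex.continuous_re.comp hΨcont).integrableOn_Icc
  -- Step 3: evaluate the integral of Ψ
  have hΨint : ∫ u in Set.Icc (-T) T, Ψ u = ∑ q ∈ s, ∑ q' ∈ s, b q * conj (b q') *
      ∏ k, (K (2 * T k) (y q k - y q' k) * K (T k) (y q k - y q' k)) := by
    simp only [hΨ]
    have hint : ∀ q q', IntegrableOn (fun u : ι → ℝ => b q * conj (b q') *
        ∏ k, (e (u k * (y q k - y q' k)) * K (2 * T k) (y q k - y q' k))) (Set.Icc (-T) T) := by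
      intro q q'
      refine (continuous_const.mul (continuous_finsetProd _ fun k _ => ?_)).integrableOn_Icc
      exact (continuous_e.comp (by fun_prop)).mul continuous_const
    rw [integral_finsetSum _ fun q _ => integrable_finsetSum _ fun q' _ => hint q q']
    refine Finset.sum_congr rfl fun q _ => ?_
    rw [integral_finsetSum _ fun q' _ => hint q q']
    refine Finset.sum_congr rfl fun q' _ => ?_
    rw [integral_const_mul]
    congr 1
    rw [setIntegral_Icc_prod (-T) T (fun k x => e (x * (y q k - y q' k)) * K (2 * T k) (y q k - y q' k))]
    refine Finset.prod_congr rfl fun k _ => ?_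
    rw [integral_mul_const, Pi.neg_apply, setIntegral_Icc_e_symm _ (hT k).le, K, K, mul_comm]
  have hre : ∫ u in Set.Icc (-T) T, (Ψ u).re = (∫ u in Set.Icc (-T) T, Ψ u).re := by
    have := ContinuousLinearMap.integral_comp_comm Complex.reCLM (hΨcont.integrableOn_Icc (μ := volume) (a := -T) (b := T))
    simpa using this
  -- Step 4: bound the real part by the norm
  have hstep4 : (∫ u in Set.Icc (-T) T, Ψ u).re ≤ ∑ q ∈ s, ∑ q' ∈ s, ‖b q‖ * ‖b q'‖ *
      ∏ k, (‖K (2 * T k) (y q k - y q' k)‖ * ‖K (T k) (y q k - y q' k)‖) := by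
    rw [hΨint]
    refine (Complex.re_le_norm _).trans ((norm_sum_le _ _).trans (Finset.sum_le_sum fun q _ => ?_))
    refine (norm_sum_le _ _).trans (Finset.sum_le_sum fun q' _ => ?_)
    rw [norm_mul, norm_mul, Complex.norm_conj, norm_prod]
    refine le_of_eq (congrArg _ (Finset.prod_congr rfl fun k _ => norm_mul _ _))
  -- Step 5: divide
  have hfin : L * ∏ k, (2 * T k) ≤ ∑ q ∈ s, ∑ q' ∈ s, ‖b q‖ * ‖b q'‖ *
      ∏ k, (‖K (2 * T k) (y q k - y q' k)‖ * ‖K (T k) (y q k - y q' k)‖) :=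
    hstep2.trans (hre.le.trans hstep4)
  rw [← le_div_iff₀ hprodpos, Finset.sum_div] at hfin
  refine hfin.trans (le_of_eq (Finset.sum_congr rfl fun q _ => ?_))
  rw [Finset.sum_div]
  refine Finset.sum_congr rfl fun q' _ => ?_
  rw [mul_div_assoc, ← Finset.prod_div_distrib]
  rfl

/-! ### Lattice sums: the combinatorial half of the mean-value lemma -/

/-- `∑_{i ∈ I} 1/i² ≤ 2` for a finite set of naturals (the term `i = 0` is `0⁻¹ = 0`). (The same
lemma is `Literature.NumberTheory.Sieve.CubicSieve.sum_inv_sq_le_two` in the Heath-Brown cubic-sieve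
development; it is re-proved here in three lines rather than importing that development.) [folklore] -/
theorem sum_nat_inv_sq_le_two (I : Finset ℕ) : ∑ i ∈ I, ((i : ℝ) ^ 2)⁻¹ ≤ 2 := by
  have hsub : I.erase 0 ⊆ Finset.Ioo 0 (I.sup id + 1) := by
    intro i hi
    rw [Finset.mem_erase] at hi
    rw [Finset.mem_Ioo]
    exact ⟨Nat.pos_of_ne_zero hi.1, Nat.lt_succ_of_le (Finset.le_sup (f := id) hi.2)⟩
  have h0 : ∑ i ∈ I, ((i : ℝ) ^ 2)⁻¹ = ∑ i ∈ I.erase 0, ((i : ℝ) ^ 2)⁻¹ := by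
    by_cases h : (0 : ℕ) ∈ I
    · rw [← Finset.sum_erase_add _ _ h]; simp
    · rw [Finset.erase_eq_of_notMem h]
  rw [h0]
  calc ∑ i ∈ I.erase 0, ((i : ℝ) ^ 2)⁻¹ ≤ ∑ i ∈ Finset.Ioo 0 (I.sup id + 1), ((i : ℝ) ^ 2)⁻¹ :=
        Finset.sum_le_sum_of_subset_of_nonneg hsub fun i _ _ => by positivity
    _ ≤ 2 / ((0 : ℕ) + 1) := sum_Ioo_inv_sq_le 0 _
    _ = 2 := by norm_num

/-- `∑_{j ∈ J} 1/j² ≤ 4` for a finite set of integers. [folklore] -/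
theorem sum_int_inv_sq_le_four (J : Finset ℤ) : ∑ j ∈ J, ((j : ℝ) ^ 2)⁻¹ ≤ 4 := by
  classical
  -- push forward along `natAbs`, whose fibres have at most two elements
  have hfib : ∀ i ∈ J.image Int.natAbs,
      ∑ j ∈ J with Int.natAbs j = i, ((j : ℝ) ^ 2)⁻¹ ≤ 2 * ((i : ℝ) ^ 2)⁻¹ := by
    intro i _
    have hval : ∀ j ∈ J.filter (fun j => Int.natAbs j = i), ((j : ℝ) ^ 2)⁻¹ = ((i : ℝ) ^ 2)⁻¹ := by
      intro j hj
      rw [Finset.mem_filter] at hj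
      rw [← hj.2, Nat.cast_natAbs, Int.cast_abs, sq_abs]
    rw [Finset.sum_congr rfl hval, Finset.sum_const, nsmul_eq_mul]
    refine mul_le_mul_of_nonneg_right ?_ (by positivity)
    have hsub : J.filter (fun j => Int.natAbs j = i) ⊆ {(i : ℤ), -(i : ℤ)} := by
      intro j hj
      rw [Finset.mem_filter] at hj
      rw [Finset.mem_insert, Finset.mem_singleton]
      rcases Int.natAbs_eq j with h | h <;> [left; right] <;> rw [h, hj.2]
    calc ((J.filter (fun j => Int.natAbs j = i)).card : ℝ) ≤ (({(i : ℤ), -(i : ℤ)} : Finset ℤ).card : ℝ) := by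
          exact_mod_cast Finset.card_le_card hsub
      _ ≤ 2 := by exact_mod_cast Finset.card_le_two
  rw [← Finset.sum_fiberwise_of_maps_to (fun j hj => Finset.mem_image_of_mem Int.natAbs hj)]
  calc ∑ i ∈ J.image Int.natAbs, ∑ j ∈ J with Int.natAbs j = i, ((j : ℝ) ^ 2)⁻¹
      ≤ ∑ i ∈ J.image Int.natAbs, 2 * ((i : ℝ) ^ 2)⁻¹ := Finset.sum_le_sum hfib
    _ = 2 * ∑ i ∈ J.image Int.natAbs, ((i : ℝ) ^ 2)⁻¹ := by rw [Finset.mul_sum]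
    _ ≤ 2 * 2 := by
        refine mul_le_mul_of_nonneg_left (sum_nat_inv_sq_le_two _) (by norm_num)
    _ = 4 := by norm_num

/-- The lattice majorant of the kernel: `g(m) = 4T` for `|m| ≤ 1`, `2/(π² T δ² m²)` otherwise. [folklore] -/
def gker (T δ : ℝ) (m : ℤ) : ℝ :=
  if m.natAbs ≤ 1 then 4 * T else 2 / (π ^ 2 * T * δ ^ 2 * (m : ℝ) ^ 2)

/-- `g ≥ 0`. [folklore] -/
theorem gker_nonneg {T δ : ℝ} (hT : 0 < T) (m : ℤ) : 0 ≤ gker T δ m := by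
  unfold gker; split_ifs <;> positivity

/-- One-dimensional lattice sums of `g`: `∑_{j ∈ J} g(j) ≤ 12T + 8/(π²Tδ²)`. [folklore] -/
theorem sum_gker_le {T δ : ℝ} (hT : 0 < T) (hδ : 0 < δ) (J : Finset ℤ) :
    ∑ j ∈ J, gker T δ j ≤ 12 * T + 8 / (π ^ 2 * T * δ ^ 2) := by
  classical
  rw [← Finset.sum_filter_add_sum_filter_not J (fun j : ℤ => j.natAbs ≤ 1)]
  have h1 : ∑ j ∈ J with j.natAbs ≤ 1, gker T δ j ≤ 12 * T := by
    have hval : ∀ j ∈ J.filter (fun j : ℤ => j.natAbs ≤ 1), gker T δ j = 4 * T := by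
      intro j hj
      rw [Finset.mem_filter] at hj
      simp [gker, hj.2]
    rw [Finset.sum_congr rfl hval, Finset.sum_const, nsmul_eq_mul]
    have hsub : J.filter (fun j : ℤ => j.natAbs ≤ 1) ⊆ Finset.Icc (-1 : ℤ) 1 := by
      intro j hj
      rw [Finset.mem_filter] at hj
      rw [Finset.mem_Icc]
      have := hj.2
      omega
    have hcard : ((J.filter (fun j : ℤ => j.natAbs ≤ 1)).card : ℝ) ≤ 3 := by
      have := Finset.card_le_card hsub
      simp at this
      exact_mod_cast this
    nlinarith
  have h2 : ∑ j ∈ J with ¬ (j.natAbs ≤ 1), gker T δ j ≤ 8 / (π ^ 2 * T * δ ^ 2) := by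
    have hval : ∀ j ∈ J.filter (fun j : ℤ => ¬ (j.natAbs ≤ 1)),
        gker T δ j = 2 / (π ^ 2 * T * δ ^ 2) * ((j : ℝ) ^ 2)⁻¹ := by
      intro j hj
      rw [Finset.mem_filter] at hj
      simp only [gker, hj.2, if_false]
      rw [div_mul_eq_mul_div, mul_comm _ ((j:ℝ)^2), ← div_div, div_eq_mul_inv]
      ring
    rw [Finset.sum_congr rfl hval, ← Finset.mul_sum]
    calc 2 / (π ^ 2 * T * δ ^ 2) * ∑ j ∈ J with ¬ (j.natAbs ≤ 1), ((j : ℝ) ^ 2)⁻¹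
        ≤ 2 / (π ^ 2 * T * δ ^ 2) * 4 :=
          mul_le_mul_of_nonneg_left (sum_int_inv_sq_le_four _) (by positivity)
      _ = 8 / (π ^ 2 * T * δ ^ 2) := by ring
  linarith

/-- With `Tδ ≥ 1` the lattice sum is at most `13 T`. [folklore] -/
theorem sum_gker_le' {T δ : ℝ} (hT : 0 < T) (hδ : 0 < δ) (hTδ : δ⁻¹ ≤ T) (J : Finset ℤ) :
    ∑ j ∈ J, gker T δ j ≤ 13 * T := by
  refine (sum_gker_le hT hδ J).trans ?_
  have hπ : (3 : ℝ) < π := Real.pi_gt_three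
  have hTδ' : 1 ≤ T * δ := by
    rw [inv_le_iff_one_le_mul₀ hδ] at hTδ; linarith [mul_comm T δ]
  -- 8/(π² T δ²) ≤ T since π² T² δ² ≥ 9
  have h : 8 / (π ^ 2 * T * δ ^ 2) ≤ T := by
    rw [div_le_iff₀ (by positivity)]
    have : (1 : ℝ) ≤ (T * δ) ^ 2 := by nlinarith
    nlinarith [sq_nonneg (T * δ), mul_pos hT hT]
  linarith

/-- Product lattice majorant. [folklore] -/
def Gker (T δ : ι → ℝ) (m : ι → ℤ) : ℝ := ∏ k, gker (T k) (δ k) (m k)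

/-- `∏ g ≥ 0`. [folklore] -/
theorem Gker_nonneg {T δ : ι → ℝ} (hT : ∀ k, 0 < T k) (m : ι → ℤ) : 0 ≤ Gker T δ m :=
  Finset.prod_nonneg fun k _ => gker_nonneg (hT k) _

/-- Lattice sums of the product majorant over any finite set of lattice vectors. [folklore] -/
theorem sum_Gker_le {T δ : ι → ℝ} (hT : ∀ k, 0 < T k) (hδ : ∀ k, 0 < δ k)
    (hTδ : ∀ k, (δ k)⁻¹ ≤ T k) (M : Finset (ι → ℤ)) :
    ∑ m ∈ M, Gker T δ m ≤ ∏ k, (13 * T k) := by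
  classical
  have hsub : M ⊆ Fintype.piFinset fun k => M.image fun m => m k := by
    intro m hm
    rw [Fintype.mem_piFinset]
    exact fun k => Finset.mem_image_of_mem _ hm
  calc ∑ m ∈ M, Gker T δ m ≤ ∑ m ∈ Fintype.piFinset (fun k => M.image fun m => m k), Gker T δ m :=
        Finset.sum_le_sum_of_subset_of_nonneg hsub fun m _ _ => Gker_nonneg hT m
    _ = ∏ k, ∑ j ∈ M.image (fun m => m k), gker (T k) (δ k) j := by
        rw [Finset.prod_univ_sum]; rfl
    _ ≤ ∏ k, (13 * T k) :=
        Finset.prod_le_prod (fun k _ => Finset.sum_nonneg fun j _ => gker_nonneg (hT k) j)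
          fun k _ => sum_gker_le' (hT k) (hδ k) (hTδ k) _

/-- The kernel is dominated by the lattice majorant of the cell difference. [folklore] -/
theorem kern_le_gker {T δ : ℝ} (hT : 0 < T) (hδ : 0 < δ) (a a' : ℝ) :
    kern T (a - a') ≤ gker T δ (⌊a / δ⌋ - ⌊a' / δ⌋) := by
  set c := ⌊a / δ⌋ with hc
  set c' := ⌊a' / δ⌋ with hc'
  have ha1 : (c : ℝ) * δ ≤ a := by
    have := Int.floor_le (a / δ); rw [← hc] at this
    rwa [le_div_iff₀ hδ] at this
  have ha2 : a < (c + 1 : ℝ) * δ := by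
    have := Int.lt_floor_add_one (a / δ); rw [← hc] at this
    rwa [div_lt_iff₀ hδ] at this
  have ha1' : (c' : ℝ) * δ ≤ a' := by
    have := Int.floor_le (a' / δ); rw [← hc'] at this
    rwa [le_div_iff₀ hδ] at this
  have ha2' : a' < (c' + 1 : ℝ) * δ := by
    have := Int.lt_floor_add_one (a' / δ); rw [← hc'] at this
    rwa [div_lt_iff₀ hδ] at this
  unfold gker
  split_ifs with h
  · exact kern_le hT _
  · -- |m| ≥ 2 : |a - a'| > (|m| - 1) δ ≥ |m| δ / 2
    rw [not_le] at h
    set m : ℤ := c - c' with hm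
    have hmR : ((m : ℤ) : ℝ) = (c : ℝ) - (c' : ℝ) := by rw [hm]; push_cast; ring
    have hlow : ((m : ℝ) - 1) * δ < a - a' := by rw [hmR]; nlinarith
    have hupp : a - a' < ((m : ℝ) + 1) * δ := by rw [hmR]; nlinarith
    have hm2 : (2 : ℤ) ≤ m ∨ m ≤ -2 := by omega
    have hsq : ((m : ℝ) * δ) ^ 2 ≤ 4 * (a - a') ^ 2 := by
      rcases hm2 with h2 | h2
      · have h2R : (2 : ℝ) ≤ m := by exact_mod_cast h2
        have hmδ : 0 ≤ (m : ℝ) * δ := by positivity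
        have : (m : ℝ) * δ ≤ 2 * (a - a') := by nlinarith
        calc ((m : ℝ) * δ) ^ 2 ≤ (2 * (a - a')) ^ 2 := pow_le_pow_left₀ hmδ this 2
          _ = 4 * (a - a') ^ 2 := by ring
      · have h2R : (m : ℝ) ≤ -2 := by exact_mod_cast h2
        have hmδ : 0 ≤ -((m : ℝ) * δ) := by nlinarith
        have : -((m : ℝ) * δ) ≤ 2 * (a' - a) := by nlinarith
        calc ((m : ℝ) * δ) ^ 2 = (-((m : ℝ) * δ)) ^ 2 := by ring
          _ ≤ (2 * (a' - a)) ^ 2 := pow_le_pow_left₀ hmδ this 2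
          _ = 4 * (a - a') ^ 2 := by ring
    have hne : a - a' ≠ 0 := by
      intro h0
      rw [h0] at hsq
      have hmne : (m : ℝ) ≠ 0 := by
        rcases hm2 with h2 | h2
        · have : (2:ℝ) ≤ m := by exact_mod_cast h2
          linarith
        · have : (m:ℝ) ≤ -2 := by exact_mod_cast h2
          linarith
      have : 0 < ((m : ℝ) * δ) ^ 2 := by positivity
      linarith
    refine (kern_le_inv hT hne).trans ?_
    have hm0 : (m : ℝ) ≠ 0 := by
      rcases hm2 with h2 | h2
      · have : (2:ℝ) ≤ m := by exact_mod_cast h2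
        intro h0; linarith
      · have : (m:ℝ) ≤ -2 := by exact_mod_cast h2
        intro h0; linarith
    have hmpos : 0 < ((m : ℝ) * δ) ^ 2 := by positivity
    have hsqpos : 0 < (a - a') ^ 2 := sq_pos_iff.mpr hne
    have hden1 : 0 < 2 * π ^ 2 * T * (a - a') ^ 2 := mul_pos (by positivity) hsqpos
    have hden2 : 0 < π ^ 2 * T * δ ^ 2 * (m : ℝ) ^ 2 := by positivity
    rw [div_le_div_iff₀ hden1 hden2]
    nlinarith [hsq, Real.pi_pos, mul_pos (mul_pos (pow_pos Real.pi_pos 2) hT) hmpos]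

/-! ### The weighted neighbour count -/

/-- **Weighted neighbour count** of a finite family of points `y_q ∈ ℝ^ι` with weights `b_q`
at scale `δ = (δ_k)`: `𝓝(b; δ) = ∑_{q, q' ∈ s, |y_{q,k} - y_{q',k}| ≤ δ_k ∀ k} |b_q| |b_{q'}|`
(Graham–Kolesnik's `𝓑(b; ·)`). [cite: GrahamKolesnik1991, Lemma 7.4, Lemma 7.5] -/
def neighbourCount (s : Finset β) (y : β → ι → ℝ) (b : β → ℂ) (δ : ι → ℝ) : ℝ :=
  ∑ q ∈ s, ∑ q' ∈ s, if ∀ k, |y q k - y q' k| ≤ δ k then ‖b q‖ * ‖b q'‖ else 0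

/-- `𝓝(b; δ) ≥ 0`. [folklore] -/
theorem neighbourCount_nonneg (s : Finset β) (y : β → ι → ℝ) (b : β → ℂ) (δ : ι → ℝ) :
    0 ≤ neighbourCount s y b δ :=
  Finset.sum_nonneg fun q _ => Finset.sum_nonneg fun q' _ => by split_ifs <;> positivity

/-- Monotonicity of the neighbour count in the scale. [folklore] -/
theorem neighbourCount_mono (s : Finset β) (y : β → ι → ℝ) (b : β → ℂ) {δ δ' : ι → ℝ}
    (h : ∀ k, δ k ≤ δ' k) : neighbourCount s y b δ ≤ neighbourCount s y b δ' := by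
  refine Finset.sum_le_sum fun q _ => Finset.sum_le_sum fun q' _ => ?_
  split_ifs with h1 h2 h2
  · exact le_rfl
  · exact absurd (fun k => (h1 k).trans (h k)) h2
  · positivity
  · exact le_rfl

/-- Rescaling the weights by factors of norm `≤ M` multiplies the neighbour count by `≤ M²`. [folklore] -/
theorem neighbourCount_mul_le (s : Finset β) (y : β → ι → ℝ) (b c : β → ℂ) (δ : ι → ℝ)
    {M : ℝ} (hM : 0 ≤ M) (hc : ∀ q ∈ s, ‖c q‖ ≤ M) :
    neighbourCount s y (fun q => b q * c q) δ ≤ M ^ 2 * neighbourCount s y b δ := by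
  unfold neighbourCount
  rw [Finset.mul_sum]
  refine Finset.sum_le_sum fun q hq => ?_
  rw [Finset.mul_sum]
  refine Finset.sum_le_sum fun q' hq' => ?_
  split_ifs
  · rw [norm_mul, norm_mul]
    have h1 := hc q hq; have h2 := hc q' hq'
    have : ‖b q‖ * ‖c q‖ * (‖b q'‖ * ‖c q'‖) = (‖c q‖ * ‖c q'‖) * (‖b q‖ * ‖b q'‖) := by ring
    rw [this, sq]
    exact mul_le_mul_of_nonneg_right (mul_le_mul h1 h2 (norm_nonneg _) hM) (by positivity)
  · simp

/-- Points in the same `δ`-cell are `δ`-close. [folklore] -/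
theorem abs_sub_lt_of_floor_div_eq {δ : ℝ} (hδ : 0 < δ) {a a' : ℝ} (h : ⌊a / δ⌋ = ⌊a' / δ⌋) :
    |a - a'| < δ := by
  have h1 := Int.abs_sub_lt_one_of_floor_eq_floor h
  rw [← sub_div, abs_div, abs_of_pos hδ, div_lt_one hδ] at h1
  exact h1

/-- **The cell argument.** With `T_k δ_k ≥ 1`:
`∑_{q,q'} |b_q||b_{q'}| ∏_k κ_{T_k}(y_{q,k} - y_{q',k}) ≤ ∏_k (13 T_k) · 𝓝(b; δ)`. [folklore] -/
theorem kernelSum_le (s : Finset β) (b : β → ℂ) (y : β → ι → ℝ) (T δ : ι → ℝ)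
    (hT : ∀ k, 0 < T k) (hδ : ∀ k, 0 < δ k) (hTδ : ∀ k, (δ k)⁻¹ ≤ T k) :
    ∑ q ∈ s, ∑ q' ∈ s, ‖b q‖ * ‖b q'‖ * ∏ k, kern (T k) (y q k - y q' k) ≤
      (∏ k, (13 * T k)) * neighbourCount s y b δ := by
  classical
  set ℓ : β → (ι → ℤ) := fun q k => ⌊y q k / δ k⌋ with hℓ
  set u : β → ℝ := fun q => ‖b q‖ with hu
  set L : Finset (ι → ℤ) := s.image ℓ with hL
  set S : (ι → ℤ) → ℝ := fun c => ∑ q ∈ s with ℓ q = c, u q with hS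
  set 𝔊 : ℝ := ∏ k, (13 * T k) with h𝔊
  have h𝔊nonneg : 0 ≤ 𝔊 := Finset.prod_nonneg fun k _ => by linarith [hT k]
  have hmaps : ∀ q ∈ s, ℓ q ∈ L := fun q hq => Finset.mem_image_of_mem ℓ hq
  -- weighted push-forward to cells
  have hmass : ∀ F : (ι → ℤ) → ℝ, ∑ q ∈ s, u q * F (ℓ q) = ∑ c ∈ L, S c * F c := by
    intro F
    rw [← Finset.sum_fiberwise_of_maps_to hmaps]
    refine Finset.sum_congr rfl fun c _ => ?_
    rw [hS, Finset.sum_mul]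
    refine Finset.sum_congr rfl fun q hq => ?_
    rw [(Finset.mem_filter.1 hq).2]
  -- Step 1: kernel ≤ lattice majorant
  have hstep1 : ∑ q ∈ s, ∑ q' ∈ s, ‖b q‖ * ‖b q'‖ * ∏ k, kern (T k) (y q k - y q' k) ≤
      ∑ q ∈ s, ∑ q' ∈ s, u q * u q' * Gker T δ (ℓ q - ℓ q') := by
    refine Finset.sum_le_sum fun q _ => Finset.sum_le_sum fun q' _ => ?_
    refine mul_le_mul_of_nonneg_left ?_ (by positivity)
    exact Finset.prod_le_prod (fun k _ => kern_nonneg (hT k) _)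
      fun k _ => kern_le_gker (hT k) (hδ k) _ _
  -- Step 2: pass to cells
  have hstep2 : ∑ q ∈ s, ∑ q' ∈ s, u q * u q' * Gker T δ (ℓ q - ℓ q') =
      ∑ c ∈ L, ∑ c' ∈ L, S c * S c' * Gker T δ (c - c') := by
    have h1 : ∀ q, ∑ q' ∈ s, u q * u q' * Gker T δ (ℓ q - ℓ q') =
        u q * ∑ c' ∈ L, S c' * Gker T δ (ℓ q - c') := by
      intro q
      rw [← hmass (fun c' => Gker T δ (ℓ q - c')), Finset.mul_sum]
      exact Finset.sum_congr rfl fun q' _ => by ring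
    simp_rw [h1]
    rw [hmass (fun c => ∑ c' ∈ L, S c' * Gker T δ (c - c'))]
    refine Finset.sum_congr rfl fun c _ => ?_
    rw [Finset.mul_sum]
    exact Finset.sum_congr rfl fun c' _ => by ring
  -- Step 3: Schur test on cells
  have hrow : ∀ c, ∑ c' ∈ L, Gker T δ (c - c') ≤ 𝔊 := by
    intro c
    have hinj : Set.InjOn (fun c' : ι → ℤ => c - c') L := fun _ _ _ _ h => sub_right_injective h
    rw [← Finset.sum_image (f := Gker T δ) hinj]
    exact sum_Gker_le hT hδ hTδ _
  have hcol : ∀ c', ∑ c ∈ L, Gker T δ (c - c') ≤ 𝔊 := by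
    intro c'
    have hinj : Set.InjOn (fun c : ι → ℤ => c - c') L := fun _ _ _ _ h => sub_left_injective h
    rw [← Finset.sum_image (f := Gker T δ) hinj]
    exact sum_Gker_le hT hδ hTδ _
  have hstep3 : ∑ c ∈ L, ∑ c' ∈ L, S c * S c' * Gker T δ (c - c') ≤ 𝔊 * ∑ c ∈ L, S c ^ 2 := by
    calc ∑ c ∈ L, ∑ c' ∈ L, S c * S c' * Gker T δ (c - c')
        ≤ ∑ c ∈ L, ∑ c' ∈ L, (S c ^ 2 / 2 * Gker T δ (c - c') + S c' ^ 2 / 2 * Gker T δ (c - c')) := by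
          refine Finset.sum_le_sum fun c _ => Finset.sum_le_sum fun c' _ => ?_
          rw [← add_mul]
          refine mul_le_mul_of_nonneg_right ?_ (Gker_nonneg hT _)
          nlinarith [two_mul_le_add_sq (S c) (S c')]
      _ = ∑ c ∈ L, S c ^ 2 / 2 * ∑ c' ∈ L, Gker T δ (c - c') +
            ∑ c' ∈ L, S c' ^ 2 / 2 * ∑ c ∈ L, Gker T δ (c - c') := by
          simp only [Finset.sum_add_distrib]
          congr 1
          · exact Finset.sum_congr rfl fun c _ => by rw [Finset.mul_sum]
          · rw [Finset.sum_comm]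
            exact Finset.sum_congr rfl fun c' _ => by rw [Finset.mul_sum]
      _ ≤ ∑ c ∈ L, S c ^ 2 / 2 * 𝔊 + ∑ c' ∈ L, S c' ^ 2 / 2 * 𝔊 :=
          add_le_add
            (Finset.sum_le_sum fun c _ => mul_le_mul_of_nonneg_left (hrow c) (by positivity))
            (Finset.sum_le_sum fun c' _ => mul_le_mul_of_nonneg_left (hcol c') (by positivity))
      _ = 𝔊 * ∑ c ∈ L, S c ^ 2 := by rw [← Finset.sum_mul, ← Finset.sum_div]; ring
  -- Step 4: same cell ⇒ close
  have hstep4 : ∑ c ∈ L, S c ^ 2 ≤ neighbourCount s y b δ := by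
    have h1 : ∑ c ∈ L, S c ^ 2 = ∑ q ∈ s, u q * S (ℓ q) := by
      rw [hmass S]; exact Finset.sum_congr rfl fun c _ => by ring
    rw [h1, neighbourCount]
    refine Finset.sum_le_sum fun q _ => ?_
    simp only [hS]
    rw [Finset.sum_filter, Finset.mul_sum]
    refine Finset.sum_le_sum fun q' _ => ?_
    by_cases hqq : ℓ q' = ℓ q
    · rw [if_pos hqq, if_pos]
      intro k
      have := congrFun hqq k
      simp only [hℓ] at this
      exact (abs_sub_lt_of_floor_div_eq (hδ k) this.symm).le
    · rw [if_neg hqq, mul_zero]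
      split_ifs <;> positivity
  calc ∑ q ∈ s, ∑ q' ∈ s, ‖b q‖ * ‖b q'‖ * ∏ k, kern (T k) (y q k - y q' k)
      ≤ ∑ c ∈ L, ∑ c' ∈ L, S c * S c' * Gker T δ (c - c') := hstep1.trans hstep2.le
    _ ≤ 𝔊 * ∑ c ∈ L, S c ^ 2 := hstep3
    _ ≤ 𝔊 * neighbourCount s y b δ := mul_le_mul_of_nonneg_left hstep4 h𝔊nonneg

/-! ### The mean-value lemma (Graham–Kolesnik Lemma 7.4, with constant `13^K`) -/

/-- **Large-sieve mean value with neighbour count** (the inequality of Graham–Kolesnik,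
*Van der Corput's Method of Exponential Sums*, Lemma 7.4, with the constant `13^K` in place of
the Beurling–Selberg constant): for points `y_q ∈ ℝ^ι`, weights `b_q ∈ ℂ` and `T_k, δ_k > 0`,
`∫_{∏[-T_k, T_k]} |∑_q b_q e(t · y_q)|² dt ≤ 13^{#ι} ∏_k (T_k + δ_k⁻¹) · 𝓝(b; δ)`,
where `𝓝(b; δ) = ∑_{|y_{q,k} - y_{q',k}| ≤ δ_k ∀k} |b_q b_{q'}|`. Proof: average over translates of the
doubled box (a Fejér-type kernel `≤ min(4T, 1/(2π²T v²))` per coordinate), then a cell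
decomposition and the Schur test. [cite: GrahamKolesnik1991, Lemma 7.4] -/
theorem largeSieve_meanValue (s : Finset β) (b : β → ℂ) (y : β → ι → ℝ) (T δ : ι → ℝ)
    (hT : ∀ k, 0 < T k) (hδ : ∀ k, 0 < δ k) :
    ∫ t in Set.Icc (-T) T, ‖trigSum s b y t‖ ^ 2 ≤
      13 ^ Fintype.card ι * (∏ k, (T k + (δ k)⁻¹)) * neighbourCount s y b δ := by
  set T' : ι → ℝ := fun k => max (T k) (δ k)⁻¹ with hT'
  have hT'pos : ∀ k, 0 < T' k := fun k => (hT k).trans_le (le_max_left _ _)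
  have hT'δ : ∀ k, (δ k)⁻¹ ≤ T' k := fun k => le_max_right _ _
  have hsub : Set.Icc (-T) T ⊆ Set.Icc (-T') T' := by
    intro t ht
    simp only [Set.mem_Icc] at ht ⊢
    refine ⟨fun k => ?_, fun k => ?_⟩
    · have := ht.1 k; simp only [Pi.neg_apply] at this ⊢
      linarith [le_max_left (T k) (δ k)⁻¹]
    · exact (ht.2 k).trans (le_max_left _ _)
  have hmono : ∫ t in Set.Icc (-T) T, ‖trigSum s b y t‖ ^ 2 ≤
      ∫ t in Set.Icc (-T') T', ‖trigSum s b y t‖ ^ 2 :=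
    setIntegral_mono_set (integrableOn_normSq_trigSum _ _ _ _ _)
      (Filter.Eventually.of_forall fun t => by positivity) (Filter.Eventually.of_forall hsub)
  refine hmono.trans ((integral_normSq_trigSum_le_kern s b y T' hT'pos).trans
    ((kernelSum_le s b y T' δ hT'pos hδ hT'δ).trans ?_))
  refine mul_le_mul_of_nonneg_right ?_ (neighbourCount_nonneg _ _ _ _)
  rw [Finset.prod_mul_distrib, Finset.prod_const, Finset.card_univ]
  refine mul_le_mul_of_nonneg_left ?_ (by positivity)
  refine Finset.prod_le_prod (fun k _ => (hT'pos k).le) fun k _ => ?_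
  exact max_le (by linarith [inv_pos.2 (hδ k)]) (by linarith [hT k])

/-! ### The double large sieve (Graham–Kolesnik Lemma 7.5 = Bombieri–Iwaniec Lemma 2.4) -/

/-- Lower bound for the short kernel: if `ε > 0` and `|u| ε ≤ 1/8` then `Re K_ε(u) ≥ ε`
(since `cos(2πtu) ≥ 1/2` for `|t| ≤ ε`). [folklore] -/
theorem le_re_K {ε u : ℝ} (hε : 0 < ε) (hu : |u| * ε ≤ 1 / 8) : ε ≤ (K ε u).re := by
  have hint : IntervalIntegrable (fun t => e (t * u)) volume (-ε) ε :=
    (continuous_e.comp (by fun_prop)).intervalIntegrable _ _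
  have hre : (K ε u).re = ∫ t in (-ε)..ε, Real.cos (2 * π * (t * u)) := by
    rw [K, ← Complex.reCLM_apply, ← ContinuousLinearMap.intervalIntegral_comp_comm _ hint]
    refine intervalIntegral.integral_congr fun t _ => ?_
    simp only [Complex.reCLM_apply]
    exact Complex.exp_ofReal_mul_I_re _
  rw [hre]
  have hcos : ∀ t ∈ Set.Icc (-ε) ε, (1 / 2 : ℝ) ≤ Real.cos (2 * π * (t * u)) := by
    intro t ht
    have htabs : |t| ≤ ε := abs_le.2 ⟨ht.1, ht.2⟩
    have hθ : |2 * π * (t * u)| ≤ π / 4 := by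
      rw [abs_mul, abs_of_pos (by positivity : (0:ℝ) < 2 * π), abs_mul]
      have : |t| * |u| ≤ 1 / 8 := by
        calc |t| * |u| ≤ ε * |u| := mul_le_mul_of_nonneg_right htabs (abs_nonneg _)
          _ = |u| * ε := mul_comm _ _
          _ ≤ 1 / 8 := hu
      nlinarith [Real.pi_pos]
    have h1 := Real.one_sub_sq_div_two_le_cos (x := 2 * π * (t * u))
    have h2 : (2 * π * (t * u)) ^ 2 ≤ (π / 4) ^ 2 := by
      rw [← sq_abs]; exact pow_le_pow_left₀ (abs_nonneg _) hθ 2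
    have h3 : (π / 4) ^ 2 ≤ 1 := by
      have := Real.pi_lt_four
      rw [div_pow, div_le_one (by norm_num)]; nlinarith [Real.pi_pos]
    linarith
  have hconst : ∫ _ in (-ε)..ε, (1 / 2 : ℝ) = ε := by
    rw [intervalIntegral.integral_const, smul_eq_mul]; ring
  calc ε = ∫ _ in (-ε)..ε, (1 / 2 : ℝ) := hconst.symm
    _ ≤ ∫ t in (-ε)..ε, Real.cos (2 * π * (t * u)) :=
        intervalIntegral.integral_mono_on (by linarith) intervalIntegrable_const
          ((Real.continuous_cos.comp (by fun_prop)).intervalIntegrable (μ := volume) _ _) hcos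

/-- `|K_ε(u)| ≥ ε` when `|u| ε ≤ 1/8`. [folklore] -/
theorem le_norm_K {ε u : ℝ} (hε : 0 < ε) (hu : |u| * ε ≤ 1 / 8) : ε ≤ ‖K ε u‖ :=
  (le_re_K hε hu).trans (Complex.re_le_norm _)

/-- The box-integral representation of `e(x · y)`:
`∫_{∏[x_k - ε_k, x_k + ε_k]} e(t · y) dt = e(x · y) ∏_k K_{ε_k}(y_k)`. [folklore] -/
theorem setIntegral_box_e_dot (x ε v : ι → ℝ) (hε : ∀ k, 0 ≤ ε k) :
    ∫ t in Set.Icc (x - ε) (x + ε), ∏ k, e (t k * v k) =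
      e (∑ k, x k * v k) * ∏ k, K (ε k) (v k) := by
  rw [setIntegral_box_e x ε v hε, Finset.prod_mul_distrib, e_sum]
  rfl

/-- `G(t) = ∑_q b_q ∏_k e(t_k y_{q,k})`. [folklore] -/
theorem trigSum_eq_prod (s : Finset β) (b : β → ℂ) (y : β → ι → ℝ) (t : ι → ℝ) :
    trigSum s b y t = ∑ q ∈ s, b q * ∏ k, e (t k * y q k) := by
  unfold trigSum
  exact Finset.sum_congr rfl fun q _ => by rw [e_sum]

/-- `|G(t)| ≤ ∑_q |b_q|`. [folklore] -/
theorem norm_trigSum_le (s : Finset β) (b : β → ℂ) (y : β → ι → ℝ) (t : ι → ℝ) :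
    ‖trigSum s b y t‖ ≤ ∑ q ∈ s, ‖b q‖ := by
  unfold trigSum
  refine (norm_sum_le _ _).trans (le_of_eq (Finset.sum_congr rfl fun q _ => ?_))
  rw [norm_mul, norm_e, mul_one]

omit [Fintype ι] in
/-- Boxes around two points that are not `2ε`-close are disjoint. [folklore] -/
theorem box_inter_box_eq_empty {x x' ε : ι → ℝ} (h : ¬ ∀ k, |x k - x' k| ≤ 2 * ε k) :
    Set.Icc (x - ε) (x + ε) ∩ Set.Icc (x' - ε) (x' + ε) = ∅ := by
  rw [Set.eq_empty_iff_forall_notMem]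
  intro t ht
  apply h
  intro k
  obtain ⟨⟨h1, h2⟩, ⟨h3, h4⟩⟩ := ht
  have h1 := h1 k; have h2 := h2 k; have h3 := h3 k; have h4 := h4 k
  simp only [Pi.sub_apply, Pi.add_apply] at h1 h2 h3 h4
  rw [abs_le]; constructor <;> linarith

variable {α : Type*}

/-- **First factor of the double large sieve**: for the weighted sum of indicators of the boxes
`∏[x_{p,k} - ε_k, x_{p,k} + ε_k]`, `∫_B (∑_p |a_p| 𝟙_{box p})² ≤ ∏_k (2ε_k) · 𝓝(a; 2ε)`. [folklore] -/
theorem integral_sq_sum_indicator_le (sX : Finset α) (x : α → ι → ℝ) (a : α → ℂ) (ε : ι → ℝ)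
    (hε : ∀ k, 0 < ε k) (B : Set (ι → ℝ)) (hBfin : volume B ≠ ⊤) :
    ∫ t in B, (∑ p ∈ sX, ‖a p‖ * (Set.Icc (x p - ε) (x p + ε)).indicator 1 t) ^ 2 ≤
      (∏ k, (2 * ε k)) * neighbourCount sX x a (fun k => 2 * ε k) := by
  classical
  set box : α → Set (ι → ℝ) := fun p => Set.Icc (x p - ε) (x p + ε) with hbox
  have hboxm : ∀ p, MeasurableSet (box p) := fun p => measurableSet_Icc
  have hvol : ∀ p, (volume (box p)).toReal = ∏ k, (2 * ε k) := by
    intro p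
    rw [hbox, Real.volume_Icc_pi_toReal]
    · exact Finset.prod_congr rfl fun k _ => by simp only [Pi.add_apply, Pi.sub_apply]; ring
    · intro k; simp only [Pi.add_apply, Pi.sub_apply]; linarith [hε k]
  -- expand the square
  have hsq : ∀ t, (∑ p ∈ sX, ‖a p‖ * (box p).indicator 1 t) ^ 2 =
      ∑ p ∈ sX, ∑ p' ∈ sX, ‖a p‖ * ‖a p'‖ * (box p ∩ box p').indicator 1 t := by
    intro t
    rw [sq, Finset.sum_mul_sum]
    refine Finset.sum_congr rfl fun p _ => Finset.sum_congr rfl fun p' _ => ?_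
    rw [Set.inter_indicator_one, Pi.mul_apply]; ring
  change ∫ t in B, (∑ p ∈ sX, ‖a p‖ * (box p).indicator 1 t) ^ 2 ≤
    (∏ k, (2 * ε k)) * neighbourCount sX x a (fun k => 2 * ε k)
  simp_rw [hsq]
  have hint : ∀ p p', IntegrableOn (fun t => ‖a p‖ * ‖a p'‖ * (box p ∩ box p').indicator 1 t) B := by
    intro p p'
    have h1 : IntegrableOn ((box p ∩ box p').indicator (1 : (ι → ℝ) → ℝ)) B volume :=
      (integrableOn_const (C := (1 : ℝ)) hBfin).indicator ((hboxm p).inter (hboxm p'))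
    exact Integrable.const_mul h1 _
  rw [integral_finsetSum _ fun p _ => integrable_finsetSum _ fun p' _ => hint p p', neighbourCount,
    Finset.mul_sum]
  refine Finset.sum_le_sum fun p _ => ?_
  rw [integral_finsetSum _ fun p' _ => hint p p', Finset.mul_sum]
  refine Finset.sum_le_sum fun p' _ => ?_
  rw [integral_const_mul]
  split_ifs with hclose
  · -- close pair: the integral is at most the volume of one box
    have h1 : ∫ t in B, (box p ∩ box p').indicator (1 : (ι → ℝ) → ℝ) t ≤ ∏ k, (2 * ε k) := by
      rw [setIntegral_indicator ((hboxm p).inter (hboxm p'))]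
      simp only [Pi.one_apply]
      rw [setIntegral_const, smul_eq_mul, mul_one, measureReal_def, ← hvol p]
      exact ENNReal.toReal_mono (measure_Icc_lt_top).ne
        (measure_mono (Set.inter_subset_right.trans Set.inter_subset_left))
    calc ‖a p‖ * ‖a p'‖ * ∫ t in B, (box p ∩ box p').indicator 1 t
        ≤ ‖a p‖ * ‖a p'‖ * ∏ k, (2 * ε k) := mul_le_mul_of_nonneg_left h1 (by positivity)
      _ = (∏ k, (2 * ε k)) * (‖a p‖ * ‖a p'‖) := by ring
  · rw [box_inter_box_eq_empty hclose]
    simp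

/-- **The double large sieve** (Bombieri–Iwaniec [B-I1] Lemma 2.4; Graham–Kolesnik Lemma 7.5;
Huxley–Watt Lemma 3.6; Bourgain 2017 (3.8)), with the explicit constant `624^K` in place of
Graham–Kolesnik's `(2π²)^K`: for finite families of points `x_p, y_q ∈ ℝ^ι` with `|x_{p,k}| ≤ X_k`,
`|y_{q,k}| ≤ Y_k` (`X_k, Y_k > 0`) and complex weights `a_p, b_q`,
`|∑_p ∑_q a_p b_q e(x_p · y_q)|² ≤ 624^{#ι} ∏_k (1 + X_k Y_k) · 𝓝(a; 1/(2Y)) · 𝓝(b; 1/(2X))`, where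
`𝓝(a; 1/(2Y)) = ∑_{|x_{p,k} - x_{p',k}| ≤ 1/(2Y_k) ∀ k} |a_p a_{p'}|` and
`𝓝(b; 1/(2X)) = ∑_{|y_{q,k} - y_{q',k}| ≤ 1/(2X_k) ∀ k} |b_q b_{q'}|`
(`Literature.NumberTheory.LFunctions.DoubleLargeSieve.neighbourCount`). Proof as in Graham–Kolesnik:
`e(x·y) = C(y) ∫_{∏[x_k-ε_k,x_k+ε_k]} e(t·y) dt` with `ε_k = 1/(8Y_k)`, `|C(y)| ≤ ∏ 8Y_k`, Cauchy–Schwarz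
in `t`, and the mean-value lemma `largeSieve_meanValue`.
[cite: GrahamKolesnik1991, Lemma 7.5] [cite: BombieriIwaniec1986, Lemma 2.4] -/
theorem doubleLargeSieve (sX : Finset α) (sY : Finset β) (x : α → ι → ℝ) (y : β → ι → ℝ)
    (a : α → ℂ) (b : β → ℂ) (X Y : ι → ℝ) (hX : ∀ k, 0 < X k) (hY : ∀ k, 0 < Y k)
    (hx : ∀ p ∈ sX, ∀ k, |x p k| ≤ X k) (hy : ∀ q ∈ sY, ∀ k, |y q k| ≤ Y k) :
    ‖∑ p ∈ sX, ∑ q ∈ sY, a p * b q * e (∑ k, x p k * y q k)‖ ^ 2 ≤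
      624 ^ Fintype.card ι * (∏ k, (1 + X k * Y k)) *
        (neighbourCount sX x a fun k => (2 * Y k)⁻¹) *
        neighbourCount sY y b fun k => (2 * X k)⁻¹ := by
  classical
  -- parameters and boxes
  set ε : ι → ℝ := fun k => (8 * Y k)⁻¹ with hε
  have hεpos : ∀ k, 0 < ε k := fun k => by have := hY k; simp only [hε]; positivity
  set box : α → Set (ι → ℝ) := fun p => Set.Icc (x p - ε) (x p + ε) with hbox
  have hboxm : ∀ p, MeasurableSet (box p) := fun p => measurableSet_Icc
  set Tb : ι → ℝ := fun k => X k + ε k with hTb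
  have hTbpos : ∀ k, 0 < Tb k := fun k => by simp only [hTb]; linarith [hX k, hεpos k]
  set B : Set (ι → ℝ) := Set.Icc (-Tb) Tb with hB
  have hBfin : volume B ≠ ⊤ := (measure_Icc_lt_top (a := -Tb) (b := Tb)).ne
  haveI : IsFiniteMeasure (volume.restrict B) := isFiniteMeasure_restrict.2 hBfin
  have hboxB : ∀ p ∈ sX, box p ⊆ B := by
    intro p hp t ht
    simp only [hbox, Set.mem_Icc] at ht
    simp only [hB, Set.mem_Icc]
    refine ⟨fun k => ?_, fun k => ?_⟩
    · have h1 := ht.1 k; have h2 := abs_le.1 (hx p hp k)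
      simp only [Pi.sub_apply, Pi.neg_apply, hTb] at h1 ⊢
      linarith [h2.1]
    · have h1 := ht.2 k; have h2 := abs_le.1 (hx p hp k)
      simp only [Pi.add_apply, hTb] at h1 ⊢
      linarith [h2.2]
  -- the compensating factors
  set Lf : β → ℂ := fun q => ∏ k, K (ε k) (y q k) with hLf
  have hLf_ge : ∀ q ∈ sY, (∏ k, ε k) ≤ ‖Lf q‖ := by
    intro q hq
    rw [hLf, norm_prod]
    refine Finset.prod_le_prod (fun k _ => (hεpos k).le) fun k _ => le_norm_K (hεpos k) ?_
    calc |y q k| * ε k ≤ Y k * ε k := mul_le_mul_of_nonneg_right (hy q hq k) (hεpos k).le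
      _ = 1 / 8 := by have := (hY k).ne'; simp only [hε]; field_simp
  have hprodε : 0 < ∏ k, ε k := Finset.prod_pos fun k _ => hεpos k
  have hLf0 : ∀ q ∈ sY, Lf q ≠ 0 := fun q hq =>
    norm_pos_iff.1 (hprodε.trans_le (hLf_ge q hq))
  set C : β → ℂ := fun q => (Lf q)⁻¹ with hC
  set M : ℝ := ∏ k, (8 * Y k) with hM
  have hMε : M = (∏ k, ε k)⁻¹ := by
    rw [hM, ← Finset.prod_inv_distrib]
    exact Finset.prod_congr rfl fun k _ => by rw [hε, inv_inv]
  have hM0 : 0 ≤ M := Finset.prod_nonneg fun k _ => by linarith [hY k]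
  have hCM : ∀ q ∈ sY, ‖C q‖ ≤ M := by
    intro q hq
    rw [hC, norm_inv, hMε]
    exact inv_anti₀ hprodε (hLf_ge q hq)
  set b' : β → ℂ := fun q => b q * C q with hb'
  set G' : (ι → ℝ) → ℂ := trigSum sY b' y with hG'
  -- Step 1: the integral representation
  have hrep : ∀ p ∈ sX, ∑ q ∈ sY, a p * b q * e (∑ k, x p k * y q k) =
      a p * ∫ t in box p, G' t := by
    intro p _
    have hint : ∀ q, IntegrableOn (fun t : ι → ℝ => b' q * ∏ k, e (t k * y q k)) (box p) :=
      fun q => (continuous_const.mul (continuous_prod_e _)).integrableOn_Icc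
    simp_rw [hG', trigSum_eq_prod]
    rw [integral_finsetSum _ fun q _ => hint q, Finset.mul_sum]
    refine Finset.sum_congr rfl fun q hq => ?_
    rw [integral_const_mul, hbox]
    simp only
    rw [setIntegral_box_e_dot (x p) ε (y q) fun k => (hεpos k).le]
    have : C q * Lf q = 1 := inv_mul_cancel₀ (hLf0 q hq)
    calc a p * b q * e (∑ k, x p k * y q k)
        = a p * b q * e (∑ k, x p k * y q k) * (C q * Lf q) := by rw [this, mul_one]
      _ = a p * (b' q * (e (∑ k, x p k * y q k) * ∏ k, K (ε k) (y q k))) := by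
          simp only [hb', hLf]; ring
  -- Step 2: norm bound by ∫_B F |G'|
  set F : (ι → ℝ) → ℝ := fun t => ∑ p ∈ sX, ‖a p‖ * (box p).indicator 1 t with hF
  have hG'cont : Continuous G' := continuous_trigSum _ _ _
  have hnormG'int : IntegrableOn (fun t => ‖G' t‖) B := hG'cont.norm.integrableOn_Icc
  have h2 : ‖∑ p ∈ sX, ∑ q ∈ sY, a p * b q * e (∑ k, x p k * y q k)‖ ≤ ∫ t in B, F t * ‖G' t‖ := by
    have hind : ∀ p ∈ sX, ∫ t in box p, ‖G' t‖ = ∫ t in B, (box p).indicator 1 t * ‖G' t‖ := by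
      intro p hp
      have : ∀ t, (box p).indicator (1 : (ι → ℝ) → ℝ) t * ‖G' t‖ =
          (box p).indicator (fun t => ‖G' t‖) t := by
        intro t
        by_cases ht : t ∈ box p <;> simp [ht]
      simp_rw [this]
      rw [setIntegral_indicator (hboxm p), Set.inter_eq_right.2 (hboxB p hp)]
    have hint : ∀ p ∈ sX, IntegrableOn (fun t => ‖a p‖ * ((box p).indicator 1 t * ‖G' t‖)) B := by
      intro p _
      refine Integrable.const_mul ?_ _
      have : (fun t => (box p).indicator (1 : (ι → ℝ) → ℝ) t * ‖G' t‖) =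
          (box p).indicator (fun t => ‖G' t‖) := by
        funext t; by_cases ht : t ∈ box p <;> simp [ht]
      rw [this]
      exact hnormG'int.indicator (hboxm p)
    calc ‖∑ p ∈ sX, ∑ q ∈ sY, a p * b q * e (∑ k, x p k * y q k)‖
        = ‖∑ p ∈ sX, a p * ∫ t in box p, G' t‖ := by rw [Finset.sum_congr rfl hrep]
      _ ≤ ∑ p ∈ sX, ‖a p‖ * ∫ t in box p, ‖G' t‖ := by
          refine (norm_sum_le _ _).trans (Finset.sum_le_sum fun p _ => ?_)
          rw [norm_mul]
          exact mul_le_mul_of_nonneg_left (norm_integral_le_integral_norm _) (norm_nonneg _)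
      _ = ∑ p ∈ sX, ∫ t in B, ‖a p‖ * ((box p).indicator 1 t * ‖G' t‖) := by
          refine Finset.sum_congr rfl fun p hp => ?_
          rw [hind p hp, integral_const_mul]
      _ = ∫ t in B, F t * ‖G' t‖ := by
          rw [← integral_finsetSum _ hint]
          refine integral_congr_ae (Filter.Eventually.of_forall fun t => ?_)
          simp only [hF, Finset.sum_mul]
          exact Finset.sum_congr rfl fun p _ => by ring
  -- Step 3: Cauchy–Schwarz
  have hFnn : ∀ t, 0 ≤ F t := fun t =>
    Finset.sum_nonneg fun p _ => mul_nonneg (norm_nonneg _) (Set.indicator_nonneg (fun _ _ => zero_le_one) _)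
  have hFle : ∀ t, F t ≤ ∑ p ∈ sX, ‖a p‖ := fun t => Finset.sum_le_sum fun p _ => by
    have : (box p).indicator (1 : (ι → ℝ) → ℝ) t ≤ 1 :=
      Set.indicator_apply_le' (fun _ => le_rfl) (fun _ => zero_le_one)
    nlinarith [norm_nonneg (a p)]
  have hFmeas : Measurable F := by
    refine Finset.measurable_sum _ fun p _ => Measurable.const_mul ?_ _
    exact measurable_one.indicator (hboxm p)
  have hFmem : MemLp F (ENNReal.ofReal 2) (volume.restrict B) := by
    refine MemLp.of_bound hFmeas.aestronglyMeasurable (∑ p ∈ sX, ‖a p‖)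
      (Filter.Eventually.of_forall fun t => ?_)
    rw [Real.norm_of_nonneg (hFnn t)]
    exact hFle t
  have hGmem : MemLp (fun t => ‖G' t‖) (ENNReal.ofReal 2) (volume.restrict B) := by
    refine MemLp.of_bound hG'cont.norm.aestronglyMeasurable (∑ q ∈ sY, ‖b' q‖)
      (Filter.Eventually.of_forall fun t => ?_)
    rw [norm_norm]
    exact norm_trigSum_le _ _ _ _
  have hCS := integral_mul_le_Lp_mul_Lq_of_nonneg (μ := volume.restrict B)
    Real.HolderConjugate.two_two (Filter.Eventually.of_forall hFnn)
    (Filter.Eventually.of_forall fun t => norm_nonneg (G' t)) hFmem hGmem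
  simp only [Real.rpow_two] at hCS
  rw [← Real.sqrt_eq_rpow, ← Real.sqrt_eq_rpow] at hCS
  have hA0 : 0 ≤ ∫ t in B, F t ^ 2 := integral_nonneg fun t => by positivity
  have hB0 : 0 ≤ ∫ t in B, ‖G' t‖ ^ 2 := integral_nonneg fun t => by positivity
  have hI0 : 0 ≤ ∫ t in B, F t * ‖G' t‖ := integral_nonneg fun t => mul_nonneg (hFnn t) (norm_nonneg _)
  have h3 : (∫ t in B, F t * ‖G' t‖) ^ 2 ≤ (∫ t in B, F t ^ 2) * ∫ t in B, ‖G' t‖ ^ 2 := by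
    have := pow_le_pow_left₀ hI0 hCS 2
    rwa [mul_pow, Real.sq_sqrt hA0, Real.sq_sqrt hB0] at this
  -- Step 4: the first factor
  have h4 : ∫ t in B, F t ^ 2 ≤ (∏ k, (2 * ε k)) * neighbourCount sX x a fun k => (2 * Y k)⁻¹ := by
    refine (integral_sq_sum_indicator_le sX x a ε hεpos B hBfin).trans ?_
    refine mul_le_mul_of_nonneg_left (neighbourCount_mono _ _ _ fun k => ?_)
      (Finset.prod_nonneg fun k _ => by linarith [hεpos k])
    have hYk := hY k
    show 2 * (8 * Y k)⁻¹ ≤ (2 * Y k)⁻¹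
    rw [show (2 * (8 * Y k)⁻¹ : ℝ) = (4 * Y k)⁻¹ by field_simp; norm_num]
    exact inv_anti₀ (by positivity) (by linarith)
  -- Step 5: the second factor, by the mean-value lemma
  have h5 : ∫ t in B, ‖G' t‖ ^ 2 ≤ 13 ^ Fintype.card ι * (∏ k, (Tb k + 2 * X k)) *
      (M ^ 2 * neighbourCount sY y b fun k => (2 * X k)⁻¹) := by
    have h := largeSieve_meanValue sY b' y Tb (fun k => (2 * X k)⁻¹) hTbpos
      (fun k => by have := hX k; positivity)
    simp only [inv_inv] at h
    refine h.trans (mul_le_mul_of_nonneg_left ?_ ?_)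
    · exact neighbourCount_mul_le sY y b C _ hM0 hCM
    · exact mul_nonneg (by positivity)
        (Finset.prod_nonneg fun k _ => by linarith [hTbpos k, hX k])
  -- Step 6: arithmetic
  have hprod : (∏ k, (2 * ε k)) * ((13 : ℝ) ^ Fintype.card ι * ∏ k, (Tb k + 2 * X k)) * M ^ 2 ≤
      624 ^ Fintype.card ι * ∏ k, (1 + X k * Y k) := by
    have hk : ∀ k, 2 * ε k * (Tb k + 2 * X k) * (8 * Y k) ^ 2 = 48 * (X k * Y k) + 2 := by
      intro k
      have hYk := (hY k).ne'
      simp only [hTb, hε]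
      field_simp
      ring
    have hsplit : ∏ k, (2 * ε k * (Tb k + 2 * X k) * (8 * Y k) ^ 2) =
        (∏ k, (2 * ε k)) * (∏ k, (Tb k + 2 * X k)) * ∏ k, (8 * Y k) ^ 2 := by
      rw [Finset.prod_mul_distrib, Finset.prod_mul_distrib]
    calc (∏ k, (2 * ε k)) * ((13 : ℝ) ^ Fintype.card ι * ∏ k, (Tb k + 2 * X k)) * M ^ 2
        = 13 ^ Fintype.card ι * ∏ k, (2 * ε k * (Tb k + 2 * X k) * (8 * Y k) ^ 2) := by
          rw [hsplit, hM, ← Finset.prod_pow]; ring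
      _ = 13 ^ Fintype.card ι * ∏ k, (48 * (X k * Y k) + 2) := by
          rw [Finset.prod_congr rfl fun k _ => hk k]
      _ ≤ 13 ^ Fintype.card ι * ∏ k, (48 * (1 + X k * Y k)) := by
          refine mul_le_mul_of_nonneg_left (Finset.prod_le_prod (fun k _ => ?_) fun k _ => ?_)
            (by positivity)
          · have := mul_pos (hX k) (hY k); positivity
          · linarith
      _ = 624 ^ Fintype.card ι * ∏ k, (1 + X k * Y k) := by
          rw [Finset.prod_mul_distrib, Finset.prod_const, Finset.card_univ,
            show (624 : ℝ) = 13 * 48 by norm_num, mul_pow]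
          ring
  -- conclusion
  set nX := neighbourCount sX x a fun k => (2 * Y k)⁻¹ with hnX
  set nY := neighbourCount sY y b fun k => (2 * X k)⁻¹ with hnY
  have hnX0 : 0 ≤ nX := neighbourCount_nonneg _ _ _ _
  have hnY0 : 0 ≤ nY := neighbourCount_nonneg _ _ _ _
  have hP0 : 0 ≤ ∏ k, (2 * ε k) := Finset.prod_nonneg fun k _ => by linarith [hεpos k]
  have hQ0 : 0 ≤ (13 : ℝ) ^ Fintype.card ι * ∏ k, (Tb k + 2 * X k) := by
    have : ∀ k, 0 < Tb k + 2 * X k := fun k => by linarith [hTbpos k, hX k]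
    exact mul_nonneg (by positivity) (Finset.prod_nonneg fun k _ => (this k).le)
  calc ‖∑ p ∈ sX, ∑ q ∈ sY, a p * b q * e (∑ k, x p k * y q k)‖ ^ 2
      ≤ (∫ t in B, F t * ‖G' t‖) ^ 2 := pow_le_pow_left₀ (norm_nonneg _) h2 2
    _ ≤ (∫ t in B, F t ^ 2) * ∫ t in B, ‖G' t‖ ^ 2 := h3
    _ ≤ ((∏ k, (2 * ε k)) * nX) *
          (13 ^ Fintype.card ι * (∏ k, (Tb k + 2 * X k)) * (M ^ 2 * nY)) :=
        mul_le_mul h4 h5 hB0 (mul_nonneg hP0 hnX0)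
    _ = ((∏ k, (2 * ε k)) * (13 ^ Fintype.card ι * ∏ k, (Tb k + 2 * X k)) * M ^ 2) * (nX * nY) := by
        ring
    _ ≤ (624 ^ Fintype.card ι * ∏ k, (1 + X k * Y k)) * (nX * nY) :=
        mul_le_mul_of_nonneg_right hprod (mul_nonneg hnX0 hnY0)
    _ = 624 ^ Fintype.card ι * (∏ k, (1 + X k * Y k)) * nX * nY := by ring

/-! ### The first spacing lemma (converse direction): neighbour count ≤ mean square -/

/-- `K_R(v)` is real: `conj K_R(v) = K_R(v)` (substitute `t ↦ -t`). [folklore] -/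
theorem conj_K (R v : ℝ) : conj (K R v) = K R v := by
  rw [K, ← intervalIntegral.intervalIntegral_conj]
  simp_rw [conj_e]
  have h := intervalIntegral.integral_comp_neg (a := -R) (b := R) (f := fun t => e (t * v))
  simp only [neg_neg] at h
  simpa [neg_mul] using h

/-- `K_R(v) = Re K_R(v)` as a complex number. [folklore] -/
theorem K_eq_re (R v : ℝ) : K R v = ((K R v).re : ℂ) :=
  (Complex.conj_eq_iff_re.1 (conj_K R v)).symm

/-- **First spacing lemma** (the converse of the mean-value lemma; Huxley, *Area, Lattice Points and
Exponential Sums*, Lemma 5.6.5, is the instance used in Bourgain's (3.10) "`A ≤ (π⁸/4) A₆`"): the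
weighted count of `(2X)⁻¹`-neighbours is dominated by the mean square, over the box `∏[-X_k, X_k]`,
of the trigonometric sum with the NONNEGATIVE weights `|b_q|`:
`𝓝(b; 1/(2X)) ≤ 8^{#ι} ∏_k X_k⁻¹ ∫_{∏[-X_k,X_k]} |∑_q |b_q| e(t·y_q)|² dt`.
Proof: for `|s_k| ≤ X_k/4` the box `s + ∏[-X_k/4, X_k/4]` lies in `∏[-X_k, X_k]`; averaging the exact
mean square over these translates gives `∑_{q,q'} |b_q||b_{q'}| ∏_k K_{X_k/4}(v_k)²` with `K` real, every
term is `≥ 0`, and for neighbours `K_{X_k/4}(v_k) ≥ X_k/4` (`le_re_K`). Stated with the constant `8^K`;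
Huxley's constant is not reproduced (his book [H] is not held; the inequality proved here is the
standard Fejér-minorant bound in the normalisation of this file). [folklore] -/
theorem neighbourCount_le_integral (s : Finset β) (b : β → ℂ) (y : β → ι → ℝ) (X : ι → ℝ)
    (hX : ∀ k, 0 < X k) :
    neighbourCount s y b (fun k => (2 * X k)⁻¹) ≤
      8 ^ Fintype.card ι * (∏ k, (X k)⁻¹) *
        ∫ t in Set.Icc (-X) X, ‖trigSum s (fun q => ((‖b q‖ : ℝ) : ℂ)) y t‖ ^ 2 := by
  classical
  set w : β → ℂ := fun q => ((‖b q‖ : ℝ) : ℂ) with hw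
  set R : ι → ℝ := fun k => X k / 4 with hR
  have hRpos : ∀ k, 0 < R k := fun k => by simp only [hR]; linarith [hX k]
  set I : ℝ := ∫ t in Set.Icc (-X) X, ‖trigSum s w y t‖ ^ 2 with hI
  have hI0 : 0 ≤ I := integral_nonneg fun t => by positivity
  -- the closed form of the mean square over the translate `u + ∏[-R_k, R_k]`
  set Ψ : (ι → ℝ) → ℂ := fun u => ∑ q ∈ s, ∑ q' ∈ s, w q * conj (w q') *
      ∏ k, (e (u k * (y q k - y q' k)) * K (R k) (y q k - y q' k)) with hΨ
  have hΦΨ : ∀ u : ι → ℝ,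
      ((∫ t in Set.Icc (u - R) (u + R), ‖trigSum s w y t‖ ^ 2 : ℝ) : ℂ) = Ψ u := by
    intro u
    rw [integral_normSq_trigSum_eq]
    refine Finset.sum_congr rfl fun q _ => Finset.sum_congr rfl fun q' _ => ?_
    congr 1
    refine Finset.prod_congr rfl fun k _ => ?_
    simp only [Pi.sub_apply, Pi.add_apply]
    rw [setIntegral_Icc_e_shift _ _ (hRpos k).le, K]
  have hΨcont : Continuous Ψ := by
    simp only [hΨ]
    refine continuous_finsetSum _ fun q _ => continuous_finsetSum _ fun q' _ =>
      continuous_const.mul (continuous_finsetProd _ fun k _ => ?_)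
    exact (continuous_e.comp (by fun_prop)).mul continuous_const
  -- upper bound: each translate lies in the big box
  have hup : ∀ u ∈ Set.Icc (-R) R, (Ψ u).re ≤ I := by
    intro u hu
    have hsub : Set.Icc (u - R) (u + R) ⊆ Set.Icc (-X) X := by
      intro t ht
      simp only [Set.mem_Icc] at hu ht ⊢
      constructor
      · intro k
        have h1 := hu.1 k; have h2 := ht.1 k
        simp only [Pi.sub_apply, Pi.neg_apply, hR] at *
        linarith [hX k]
      · intro k
        have h1 := hu.2 k; have h2 := ht.2 k
        simp only [Pi.add_apply, hR] at *
        linarith [hX k]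
    have h1 : (∫ t in Set.Icc (u - R) (u + R), ‖trigSum s w y t‖ ^ 2) ≤ I :=
      setIntegral_mono_set (integrableOn_normSq_trigSum _ _ _ _ _)
        (Filter.Eventually.of_forall fun t => by positivity) (Filter.Eventually.of_forall hsub)
    have h2 : (∫ t in Set.Icc (u - R) (u + R), ‖trigSum s w y t‖ ^ 2) = (Ψ u).re := by
      rw [← hΦΨ u, Complex.ofReal_re]
    linarith
  have hvol : (volume (Set.Icc (-R) R)).toReal = ∏ k, (2 * R k) := by
    rw [Real.volume_Icc_pi_toReal (fun k => by simp only [Pi.neg_apply]; linarith [hRpos k])]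
    exact Finset.prod_congr rfl fun k _ => by simp only [Pi.neg_apply]; ring
  have hstepU : (∫ u in Set.Icc (-R) R, Ψ u).re ≤ (∏ k, (2 * R k)) * I := by
    have hre : (∫ u in Set.Icc (-R) R, Ψ u).re = ∫ u in Set.Icc (-R) R, (Ψ u).re := by
      have := ContinuousLinearMap.integral_comp_comm Complex.reCLM
        (hΨcont.integrableOn_Icc (μ := volume) (a := -R) (b := R))
      simpa using this.symm
    rw [hre]
    have h1 : ∫ _ in Set.Icc (-R) R, I = (∏ k, (2 * R k)) * I := by
      rw [setIntegral_const, smul_eq_mul, measureReal_def, hvol]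
    rw [← h1]
    exact setIntegral_mono_on (Complex.continuous_re.comp hΨcont).integrableOn_Icc
      (integrableOn_const (measure_Icc_lt_top (a := -R) (b := R)).ne) measurableSet_Icc hup
  -- the integral of Ψ in closed form: ∑ w w' ∏ K²
  have hΨint : ∫ u in Set.Icc (-R) R, Ψ u =
      ∑ q ∈ s, ∑ q' ∈ s, w q * conj (w q') * ∏ k, K (R k) (y q k - y q' k) ^ 2 := by
    simp only [hΨ]
    have hint : ∀ q q', IntegrableOn (fun u : ι → ℝ => w q * conj (w q') *
        ∏ k, (e (u k * (y q k - y q' k)) * K (R k) (y q k - y q' k))) (Set.Icc (-R) R) := by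
      intro q q'
      refine (continuous_const.mul (continuous_finsetProd _ fun k _ => ?_)).integrableOn_Icc
      exact (continuous_e.comp (by fun_prop)).mul continuous_const
    rw [integral_finsetSum _ fun q _ => integrable_finsetSum _ fun q' _ => hint q q']
    refine Finset.sum_congr rfl fun q _ => ?_
    rw [integral_finsetSum _ fun q' _ => hint q q']
    refine Finset.sum_congr rfl fun q' _ => ?_
    rw [integral_const_mul]
    congr 1
    rw [setIntegral_Icc_prod (-R) R (fun k x => e (x * (y q k - y q' k)) * K (R k) (y q k - y q' k))]
    refine Finset.prod_congr rfl fun k _ => ?_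
    rw [integral_mul_const, Pi.neg_apply, setIntegral_Icc_e_symm _ (hRpos k).le, K, sq]
  -- lower bound: every term is real ≥ 0, and neighbours contribute ≥ ∏ R_k²
  have hterm : ∀ q q', w q * conj (w q') * ∏ k, K (R k) (y q k - y q' k) ^ 2 =
      ((‖b q‖ * ‖b q'‖ * ∏ k, (K (R k) (y q k - y q' k)).re ^ 2 : ℝ) : ℂ) := by
    intro q q'
    simp only [hw, Complex.conj_ofReal]
    push_cast
    congr 1
    refine Finset.prod_congr rfl fun k _ => ?_
    rw [← K_eq_re]
  have hlow : (∏ k, R k ^ 2) * neighbourCount s y b (fun k => (2 * X k)⁻¹) ≤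
      (∫ u in Set.Icc (-R) R, Ψ u).re := by
    rw [hΨint]
    simp_rw [hterm]
    simp only [Complex.re_sum, Complex.ofReal_re]
    rw [neighbourCount, Finset.mul_sum]
    refine Finset.sum_le_sum fun q _ => ?_
    rw [Finset.mul_sum]
    refine Finset.sum_le_sum fun q' _ => ?_
    split_ifs with hclose
    · rw [mul_comm]
      refine mul_le_mul_of_nonneg_left ?_ (by positivity)
      refine Finset.prod_le_prod (fun k _ => by positivity) fun k _ => ?_
      have hk : R k ≤ (K (R k) (y q k - y q' k)).re := by
        refine le_re_K (hRpos k) ?_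
        calc |y q k - y q' k| * R k ≤ (2 * X k)⁻¹ * R k :=
              mul_le_mul_of_nonneg_right (hclose k) (hRpos k).le
          _ = 1 / 8 := by have := (hX k).ne'; simp only [hR]; field_simp; norm_num
      exact pow_le_pow_left₀ (hRpos k).le hk 2
    · rw [mul_zero]
      exact mul_nonneg (by positivity) (Finset.prod_nonneg fun k _ => by positivity)
  -- combine
  have hmain : (∏ k, R k ^ 2) * neighbourCount s y b (fun k => (2 * X k)⁻¹) ≤
      (∏ k, (2 * R k)) * I := hlow.trans hstepU
  have hR2 : 0 < ∏ k, R k ^ 2 := Finset.prod_pos fun k _ => by have := hRpos k; positivity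
  rw [← le_div_iff₀' hR2] at hmain
  have hcoef : (∏ k, (2 * R k)) / (∏ k, R k ^ 2) = 8 ^ Fintype.card ι * ∏ k, (X k)⁻¹ := by
    rw [← Finset.prod_div_distrib, ← Finset.card_univ, ← Finset.prod_const,
      ← Finset.prod_mul_distrib]
    refine Finset.prod_congr rfl fun k _ => ?_
    have hXk := (hX k).ne'
    simp only [hR]
    rw [div_pow, div_div_eq_mul_div, div_eq_iff (by positivity)]
    field_simp
    norm_num
  calc neighbourCount s y b (fun k => (2 * X k)⁻¹)
      ≤ (∏ k, (2 * R k)) * I / ∏ k, R k ^ 2 := hmain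
    _ = (∏ k, (2 * R k)) / (∏ k, R k ^ 2) * I := by ring
    _ = 8 ^ Fintype.card ι * (∏ k, (X k)⁻¹) * I := by rw [hcoef]

/-! ### Counting forms (unit / unimodular weights) and power sums, as in Bourgain's (3.8)–(3.10) -/

/-- The number of ordered `δ`-close pairs `(q, q') ∈ s × s`: `#{(q,q') : |y_{q,k} - y_{q',k}| ≤ δ_k ∀ k}`
(Bourgain's `A`, `B₁` of (3.9), with `≤` in place of `<`). [cite: BourgainJAMS2017, §4 eq. (3.9)] -/
def closePairs (s : Finset β) (y : β → ι → ℝ) (δ : ι → ℝ) : ℕ :=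
  ((s ×ˢ s).filter fun qq' => ∀ k, |y qq'.1 k - y qq'.2 k| ≤ δ k).card

/-- For weights of modulus `≤ 1` the weighted neighbour count is at most the number of close pairs.
[folklore] -/
theorem neighbourCount_le_closePairs (s : Finset β) (y : β → ι → ℝ) (b : β → ℂ) (δ : ι → ℝ)
    (hb : ∀ q ∈ s, ‖b q‖ ≤ 1) : neighbourCount s y b δ ≤ closePairs s y δ := by
  classical
  rw [closePairs, Finset.card_filter, Nat.cast_sum, Finset.sum_product, neighbourCount]
  refine Finset.sum_le_sum fun q hq => Finset.sum_le_sum fun q' hq' => ?_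
  by_cases h : ∀ k, |y q k - y q' k| ≤ δ k
  · rw [if_pos h, if_pos h, Nat.cast_one]
    calc ‖b q‖ * ‖b q'‖ ≤ 1 * 1 := mul_le_mul (hb q hq) (hb q' hq') (norm_nonneg _) zero_le_one
      _ = 1 := one_mul _
  · rw [if_neg h, if_neg h, Nat.cast_zero]

/-- For unit weights the neighbour count IS the number of close pairs. [folklore] -/
theorem neighbourCount_one (s : Finset β) (y : β → ι → ℝ) (δ : ι → ℝ) :
    neighbourCount s y (fun _ => 1) δ = closePairs s y δ := by
  classical
  rw [closePairs, Finset.card_filter, Nat.cast_sum, Finset.sum_product, neighbourCount]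
  refine Finset.sum_congr rfl fun q _ => Finset.sum_congr rfl fun q' _ => ?_
  by_cases h : ∀ k, |y q k - y q' k| ≤ δ k
  · rw [if_pos h, if_pos h]; simp
  · rw [if_neg h, if_neg h]; simp

/-- **Double large sieve, counting form** (the shape of Bourgain's (3.8)): for weights of modulus
`≤ 1`, `|∑_p ∑_q a_p b_q e(x_p·y_q)|² ≤ 624^K ∏_k (1 + X_k Y_k) · A · B` with
`A = #{(p,p') : |x_{p,k} - x_{p',k}| ≤ (2Y_k)⁻¹ ∀k}`, `B = #{(q,q') : |y_{q,k} - y_{q',k}| ≤ (2X_k)⁻¹ ∀k}`.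
[cite: GrahamKolesnik1991, Lemma 7.5] [cite: BourgainJAMS2017, §4 eq. (3.8)–(3.9)] -/
theorem doubleLargeSieve_count (sX : Finset α) (sY : Finset β) (x : α → ι → ℝ) (y : β → ι → ℝ)
    (a : α → ℂ) (b : β → ℂ) (X Y : ι → ℝ) (hX : ∀ k, 0 < X k) (hY : ∀ k, 0 < Y k)
    (hx : ∀ p ∈ sX, ∀ k, |x p k| ≤ X k) (hy : ∀ q ∈ sY, ∀ k, |y q k| ≤ Y k)
    (ha : ∀ p ∈ sX, ‖a p‖ ≤ 1) (hb : ∀ q ∈ sY, ‖b q‖ ≤ 1) :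
    ‖∑ p ∈ sX, ∑ q ∈ sY, a p * b q * e (∑ k, x p k * y q k)‖ ^ 2 ≤
      624 ^ Fintype.card ι * (∏ k, (1 + X k * Y k)) *
        closePairs sX x (fun k => (2 * Y k)⁻¹) * closePairs sY y (fun k => (2 * X k)⁻¹) := by
  refine (doubleLargeSieve sX sY x y a b X Y hX hY hx hy).trans ?_
  have h0 : 0 ≤ (624 : ℝ) ^ Fintype.card ι * ∏ k, (1 + X k * Y k) :=
    mul_nonneg (by positivity) (Finset.prod_nonneg fun k _ => by nlinarith [hX k, hY k])
  have hA := neighbourCount_le_closePairs sX x a (fun k => (2 * Y k)⁻¹) ha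
  have hB := neighbourCount_le_closePairs sY y b (fun k => (2 * X k)⁻¹) hb
  calc 624 ^ Fintype.card ι * (∏ k, (1 + X k * Y k)) *
        (neighbourCount sX x a fun k => (2 * Y k)⁻¹) * neighbourCount sY y b (fun k => (2 * X k)⁻¹)
      ≤ 624 ^ Fintype.card ι * (∏ k, (1 + X k * Y k)) *
        closePairs sX x (fun k => (2 * Y k)⁻¹) * neighbourCount sY y b (fun k => (2 * X k)⁻¹) :=
        mul_le_mul_of_nonneg_right (mul_le_mul_of_nonneg_left hA h0) (neighbourCount_nonneg _ _ _ _)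
    _ ≤ 624 ^ Fintype.card ι * (∏ k, (1 + X k * Y k)) *
        closePairs sX x (fun k => (2 * Y k)⁻¹) * closePairs sY y (fun k => (2 * X k)⁻¹) :=
        mul_le_mul_of_nonneg_left hB (mul_nonneg h0 (Nat.cast_nonneg _))

/-- **Power sums as trigonometric sums over tuples**: for a finite set `A`, a map `φ : γ → ℝ^ι` and
tuples `h ∈ A^J`, `∑_{h ∈ A^J} e(z · ∑_j φ(h_j)) = (∑_{a ∈ A} e(z · φ(a)))^{#J}` — e.g. Bourgain's
`∑_{𝐡 ∈ (0,H]⁶} e(𝐲(𝐡)·z) = (∑_{h ≤ H} e((h, h², h^{3/2}, h^{1/2})·z))⁶` with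
`𝐲(𝐡) = ∑_{j ≤ 6} (h_j, h_j², h_j^{3/2}, h_j^{1/2})`. [cite: BourgainJAMS2017, §4 (display after (3.9))] -/
theorem trigSum_piFinset_one {γ J : Type*} [Fintype J] [DecidableEq J] (A : Finset γ)
    (φ : γ → ι → ℝ) (z : ι → ℝ) :
    trigSum (Fintype.piFinset fun _ : J => A) (fun _ => (1 : ℂ)) (fun h k => ∑ j, φ (h j) k) z =
      (∑ a ∈ A, e (∑ k, z k * φ a k)) ^ Fintype.card J := by
  unfold trigSum
  simp only [one_mul]
  have hswap : ∀ h : J → γ, (∑ k, z k * ∑ j, φ (h j) k) = ∑ j, ∑ k, z k * φ (h j) k := by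
    intro h
    rw [Finset.sum_comm]
    exact Finset.sum_congr rfl fun k _ => Finset.mul_sum _ _ _
  rw [Finset.sum_congr rfl fun h _ => by rw [hswap, e_sum],
    ← Finset.prod_univ_sum (fun _ : J => A) (fun j a => e (∑ k, z k * φ a k)), Finset.prod_const,
    Finset.card_univ]

/-- **First spacing count ≤ power-moment integral** (the shape of Bourgain's use of [H] Lemma 5.6.5
before (3.10)): with `𝐲(𝐡) = ∑_j φ(h_j)` for `𝐡 ∈ A^J`,
`#{(𝐡,𝐡') : |y_k(𝐡) - y_k(𝐡')| ≤ (2X_k)⁻¹ ∀k} ≤ 8^K ∏_k X_k⁻¹ ∫_{∏[-X_k,X_k]} |∑_{a∈A} e(z·φ(a))|^{2#J} dz`.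
[cite: BourgainJAMS2017, §4 (display after (3.9))] -/
theorem closePairs_piFinset_le_integral {γ J : Type*} [Fintype J] [DecidableEq J] (A : Finset γ)
    (φ : γ → ι → ℝ) (X : ι → ℝ) (hX : ∀ k, 0 < X k) :
    (closePairs (Fintype.piFinset fun _ : J => A) (fun h k => ∑ j, φ (h j) k)
        (fun k => (2 * X k)⁻¹) : ℝ) ≤
      8 ^ Fintype.card ι * (∏ k, (X k)⁻¹) *
        ∫ z in Set.Icc (-X) X, ‖∑ a ∈ A, e (∑ k, z k * φ a k)‖ ^ (2 * Fintype.card J) := by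
  have h := neighbourCount_le_integral (Fintype.piFinset fun _ : J => A) (fun _ => (1 : ℂ))
    (fun h k => ∑ j, φ (h j) k) X hX
  rw [neighbourCount_one] at h
  refine h.trans (le_of_eq ?_)
  congr 1
  refine integral_congr_ae (Filter.Eventually.of_forall fun z => ?_)
  simp only [norm_one, Complex.ofReal_one]
  rw [trigSum_piFinset_one, norm_pow, ← pow_mul, mul_comm]

end DoubleLargeSieve
end Literature.NumberTheory.LFunctions
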